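import Literature.Probability.FitznerVanDerHofstad2017.NobleBoundsN0
import Literature.Probability.FitznerVanDerHofstad2017.NobleInitialPoint
import Literature.Barriers.CriticalPhenomena.GaussianDominationRouteLaceExpansionProp61
import HarnessLib

/-!
# Fitzner–van der Hofstad (2017), Lemma 3.3 and §3.3: the NoBLE expansion IDENTITIES for percolation

R. Fitzner, R. van der Hofstad, *Mean-field behavior for nearest-neighbor percolation in d > 10*,
Electron. J. Probab. **22** (2017) no. 43, arXiv:1506.07977v2 (equation numbers are shared by the two versions;
pages below are arXiv-v2 pages unless marked EJP).  This module PROVES, for the tree's typed NoBLE coefficients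
(`Literature.Barriers.CriticalPhenomena.LaceExpansionNobleCoefficients`: the nesting operator `nobleOp`/`nobleIter`,
`nobleXiBT`/`noblePsiBT`/`nobleRBT` = `Ξ^{B,(N)}(v,x;A)`, `Ψ^{B,(N),κ}(v,u;A)`, `|R^B_N|(v,x;A)` of (3.23)–(3.33), the
completed `nobleXiN`/`noblePsiN`/`nobleR` of (3.41)–(3.44) and `nobleXiIotaN`/`noblePiN`/`nobleRIota` of
(3.53)–(3.57), the partial sums `nobleXiM`, `noblePsiM`, `nobleXiIotaM`, `noblePiM`, and the completed alternating
series `nobleXi`, `noblePsi`, `nobleXiIota`, `noblePi` of `NobleAssumptions`), the expansion IDENTITIES of the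
non-backtracking lace expansion: Lemma 3.3 for every `M`, Proposition 2.1 (2.14) for every `M ≥ 0` and (2.15) for every
`M ≥ 1`, and — under the `N`-summability of the coefficients — the `M → ∞` equations (1.24)–(1.25) of [NoBLE17], i.e.
the tree's structure `PercolationNobleEquationAt d p`.  As a consequence the hypothesis
`hEq : ∀ p ∈ (p_I,p_c), PercolationNobleEquationAt d p` of the bookkeeping theorems
`nobleImprovementInputsAt_of_prop45ii(_summed)` is DISCHARGED (`nobleImprovementInputsAt_of_prop45ii_identity`).
Nothing is cited as a hypothesis and no named fact is introduced: every `[cite:]` tag is provenance; the only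
non-kernel input of the final corollaries is their explicit binder `hfact` (the hybrid Prop. 4.5(ii), unchanged).

## The printed statements (verbatim, arXiv:1506.07977v2)

* Lemma 3.3 (General NoBLE equation), p. 23: "Fix `x,y ∈ ℤ^d`. Let `M ∈ ℕ`, `A` be any deterministic set of vertices
  and `B` be any deterministic set of bonds satisfying that either `B ⊆ B(x)` or `B = B(A′)` for some set of vertices
  `A′ ⊆ ℤ^d`. Then there exist `Ξ^B_M`, `Ψ^{B,κ}_M` and `R^B_M` such that
  `P^B(x ↔^A y) = Ξ^B_M(x,y;A) + Σ_{w,κ} p Ψ^{B,κ}_M(x,w;A) τ^κ(y − w + e_κ) + R^B_M(x,y;A)`. (3.10)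
  The dependence of `Ξ^B_M` and `Ψ^{B,κ}_M` on `M` is given by `Ξ^B_M(x,y;A) = Σ_{N=0}^{M} (−1)^N Ξ^{B,(N)}(x,y;A)`,
  `Ψ^{B,κ}_M(x,w;A) = Σ_{N=0}^{M} (−1)^N Ψ^{B,(N),κ}(x,w;A)`, (3.11) with `Ξ^{B,(N)}(x,y;A)` and `Ψ^{B,(N),κ}(x,w;A)`
  independent of `M`."  Its proof, pp. 24–27: the partition over the cutting bond (3.15)–(3.16) (p. 24); Lemma 3.5
  (The cutting lemma) (3.17) and its `P^B` form (3.18) (p. 24); (3.19)–(3.22) and the level-0 terms (3.23)–(3.25)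
  (p. 25); p. 26: "where the last equality holds since `b ∉ B`, so that also `b ∉ A′` trivially holds. … Further,
  after this change, we may remove the restriction `b ∉ B` from the sum, since the expectation is trivially zero for
  `b ∈ B`, both when `B ⊆ B(x)` and when `B = B(A′)`.  This proves Lemma 3.3 for `M = 0`. To continue the expansion,
  we use (3.22) and `B(b̄) ⊆ B(C̃^b_0(x))` since `b̄ ∈ C̃^b_0(x)`, to rewrite the factor
  `P^{b̲}_1(b̄ ↔ y through C̃^b_0(x) ∪ A′)` appearing in `R^B_0(x,y;A)` as (3.26)"; "We insert (3.26) into `R^B_0(x,y;A)`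
  and obtain (3.10) for `M = 1` with (3.27)–(3.29) … This proves Lemma 3.3 for `M = 1`. We now repeat using (3.26)
  recursively, for `P^{b̲_M}_{M+1}(b̄_M ↔ y through C̃_M)` (3.30) that appears in the remainder term `R^B_M(x,y;A)`.
  This leads to Lemma 3.3 for all `M ≥ 0` with `Ξ^{B,(N)}`, `Ψ^{B,(N),κ}` and `R^B_N` given in (3.23)–(3.25) for
  `N = 0`, in (3.27)–(3.29) for `N = 1` and for `N ≥ 2` given by (3.31)–(3.33)" (pp. 26–27).
* Proposition 2.1 (Non-backtracking lace expansion), p. 10 (EJP p. 10): "For every `x ∈ ℤ^d`,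
  `ι, κ ∈ {±1, ±2, …, ±d}`, and `M ≥ 1`, the following recursion relations hold:
  `τ(x) = δ_{0,x} + μ_p Σ_{y ∈ ℤ^d, κ ∈ {±1,…,±d}} (δ_{0,y} + Ψ^κ_M(y)) τ^κ(x − y + e_κ) + Ξ_M(x)`, (2.14)
  `τ(x) = τ^ι(x) + μ_p τ^{−ι}(x − e_ι) + Σ_{y ∈ ℤ^d, κ ∈ {±1,…,±d}} Π^{ι,κ}_M(y) τ^κ(x − y + e_κ) + Ξ^ι_M(x)`, (2.15)
  where `Π^{ι,κ}_M(y) = Σ_{N=0}^{M} (−1)^N Π^{(N),ι,κ}(y)`, `Ξ_M(x) = R_M(x) + Σ_{N=0}^{M} (−1)^N Ξ^{(N)}(x)`, (2.16)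
  `Ψ^κ_M(x) = Σ_{N=0}^{M} (−1)^N Ψ^{(N),κ}(y)`, `Ξ^ι_M(x) = R^ι_M(x) + Σ_{N=0}^{M} (−1)^N Ξ^{(N),ι}(x)`, (2.17)"
  (p. 11 for (2.16)–(2.20)).  In the tree the partial sums `nobleXiM`, `nobleXiIotaM` EXCLUDE the remainders, which
  appear separately as `nobleR`, `nobleRIota` — the form of (3.45) and (3.52).
* §3.3 (Completion of the NoBLE), pp. 28–30: (3.39) (Lemma 3.3 with `B = ∅`, `A = {0}`); (3.40) "We note that
  `Ξ^{∅,(0)}(0,0;{0}) = 1` and `Ψ^{∅,(0),κ}(0,0;{0}) = P(−e_κ ∉ C̃^{(0,−e_κ)}(0)) = P(0 ↮ −e_κ off the bond {0,−e_κ})`";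
  (3.41)–(3.44) (the definitions of `Ξ^{(N)}`, `Ψ^{(N),κ} = (p/μ_p)(1−δ·)Ψ^{∅,(N),κ}`, "with
  `μ_p = p P(e_κ ∉ C̃^{(0,e_κ)}(0))`", `Ξ_M`, `Ψ^κ_M`, `R_M = R^∅_M(0,x;{0})`); (3.45) "In this notation, (3.39) becomes
  `τ(x) = δ_{0,x} + Ξ_M(x) + μ_p Σ_{w,κ} (δ_{0,w} + Ψ^κ_M(w)) τ^κ(x − w + e_κ) + R_M(x)`. This proves the first relation of
  the NoBLE in (2.14)." (p. 28); (3.46) "`τ(x) − τ^ι(x) = P(0 ↔^{e_ι} x) = P(0 ↔^{b_ι} x) + P^{b_ι}(0 ↔^{e_ι} x)`";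
  (3.47)–(3.50) (the cutting lemma for `b_ι`, `P_1 = P^0_1` off `C̃`, inclusion–exclusion, Lemma 3.3 with `B = B(0)`
  and `A = C̃^{b_ι}_0(0)`); (3.51) (Lemma 3.3 with `B = {b_ι} ⊆ B(0)`, `A = {e_ι}`); (3.52) "Combining (3.46), (3.50)
  and (3.51) concludes the derivation of (2.15), i.e.,
  `τ(x) = τ^ι(x) + μ_p τ^{−ι}(x − e_ι) + Σ_{y,κ} Π^{ι,κ}_M(y) τ^κ(x − y + e_κ) + Ξ^ι_M(x) + R^ι_M(x)`" (p. 29) with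
  (3.53)–(3.54) (`N = 0`) and (3.55)–(3.57) "for `N, M ≥ 1`" (p. 30).
* after (3.37), pp. 27–28: "Naturally, the convergence of the expansion needs to be obtained to reach the above
  conclusion. This convergence follows from (3.35) and the bounds on `Ψ^{B,(N),κ}` that we prove in Section 4, by
  showing that the remainder term `R^B_N` converges to zero."; §3.5 (3.74), p. 32 ([16, Assumption 4.2] for
  percolation): "`Ψ^{(N),κ}_p(x) ≤ (p/μ_p) Ξ^{(N)}_p(x)`, `Π^{(N),ι,κ}_p(x) ≤ p Ξ^{(N),ι}_p(x)`" (tree theorems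
  `noblePsiN_le`, `noblePiN_le`).

## What is proved here

* §B `probOff_connThrough_eq_laceE_add_tsum` ((3.16) read off an arbitrary bond set `B`), `probOff_cut_eq` (the
  cutting lemma (3.17)–(3.18) in the measure `P^B`, with the `P^B`-specific factor `𝟙{{a,b} ∉ B}`); §C additivity of
  the nesting operator and its dependence on adjacent pairs only (`nobleOp_add`, `nobleOp_congr_adj`, `nobleOp_push`).
* §D–§E **Lemma 3.3 for all `M` and general outer data**: the level-0 identity
  `P^B(v ↔ x through A) + |R^B_0| = Ξ^{B,(0)} + Σ_uΣ_κ pΨ^{B,(0),κ}(v,u;A)τ^κ(x−u+e_κ)` (`probOff_connThrough_add_nobleRBT_zero`,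
  for `B(A′) ⊆ B ⊆ B({v} ∪ A′)` and no degenerate cells, TYPING READING (a)), the inner identity (3.26)
  (`nobleKerThrough_add_nobleOpW`, `v ≠ w`), the level recursion `|R^B_n| + |R^B_{n+1}| = Ξ^{B,(n+1)} + Σ pΨ^{B,(n+1)}τ`
  (`nobleRBT_add_succ`, NO hypothesis on the outer data), and the real telescoped form (3.10)–(3.11) with
  `R^B_M = (−1)^{M+1}|R^B_M|` (`probOff_connThrough_toReal_eq_alternating`, `d ≥ 2`, `p < p_c`).
* §F the two constants of (3.40): `Ξ^{∅,(0)}(0,0;{0}) = 1` (`nobleXiBT_empty_eq`) and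
  `p Ψ^{∅,(0),κ}(0,0;{0}) = μ_p` for EVERY `κ` (`ofReal_mul_noblePsiBT_empty_origin`; the `κ`-independence is the
  lattice symmetry of `NobleSymmetry`, the value is the tree's `nobleMu_eq`).
* §G **Proposition 2.1 (2.14) at every finite `M ≥ 0`** in the form (3.45): `noble_eq_one_finite`
  `τ_p(x) = δ_{0,x} + Ξ_M(x) + μ_p [Σ_ι τ^ι(x+e_ι) + Σ_yΣ_ι Ψ^ι_M(y) τ^ι(x−y+e_ι)] + R_M(x)` (`d ≥ 2`, `p < p_c`).
* §H **Proposition 2.1 (2.15) at every finite `M ≥ 1`** in the form (3.52): `noble_eq_two_finite`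
  `τ_p(x) = τ^ι(x) + μ_p τ^{−ι}(x−e_ι) + Σ_yΣ_κ Π^{ι,κ}_M(y) τ^κ(x−y+e_κ) + Ξ^ι_M(x) + R^ι_M(x)`, via (3.46)
  (`ofReal_tau_eq_add`, `measure_connThrough_singleton_eq_add`), (3.47)–(3.50) (`measure_pivotal_add_nobleIotaCorr_eq`,
  `ofReal_mul_measure_stepVec_notMem`: `p P(e_ι ∉ C̃^{b_ι}(0)) = μ_p`), the inner Lemma 3.3 identities integrated against
  `p 𝔼^{b_ι}_0[𝟙{e_ι ∉ C̃}(·)]` (`nobleIotaCorr_add`, `nobleIotaCorr_innerSeq_add_eq`) and (3.51).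
* §I **the `M → ∞` equations** (`d ≥ 2`, `0 < p < p_c`): from `Σ_N Σ_x Ξ^{(N)}_p(x) < ∞`, (1.24)
  (`noble_eq_one_of_summable`); from `Σ_N Σ_x Ξ^{(N),ι}_p(x) < ∞`, (1.25) (`noble_eq_two_of_summable`); both together
  give `PercolationNobleEquationAt d p` (`percolationNobleEquationAt_of_summable`): the other convergences asserted by
  that structure (`Σ_N Ψ^{(N),κ}`, `Σ_N Π^{(N),ι,κ}`, absolute convergence of the `y`-sums) are DERIVED from (3.74) and
  `τ^κ ≤ 1`, the remainders tend to `0` by the tree's (2.19)–(2.20) in the form `|R_M(x)| ≤ Σ_yΣ_κΨ^{(M),κ}(y)`,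
  `|R^ι_M(x)| ≤ Σ_yΣ_κΠ^{(M),ι,κ}(y)` (`NobleRemainderBound`: general terms of convergent series), and the `y`-sums pass
  to the limit by dominated convergence (Tannery's theorem, dominating function `Σ_κ Σ_N Ψ^{(N),κ}(y)` resp.
  `Σ_κ Σ_N Π^{(N),ι,κ}(y)`).
* §J `nobleImprovementInputsAt_of_prop45ii_identity` / `…_printed_identity`: the bookkeeping corollaries of
  `NobleAssumptions` / `NobleRelationSummed` with BOTH extra binders `hEq` and `hSum` discharged — on the NoBLE window
  the `N`-summability is read off the `NSumLE` clauses `NobleAssumption43At.xiAbs`, `.xiIotaAbs` ([NoBLE17] Assumption 4.3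
  (4.31)/(4.49)) that the binder `h43` supplies under the bootstrap hypothesis `f_i(p) ≤ Γ_i`.
* §K the same AT THE INITIAL POINT `p_I = 1/(2d-1)`, which is strictly subcritical by the tree theorem
  `nbwThresholdI_lt_criticalProbI` (module `NobleInitialPoint`; Grimmett (1.13) with `λ(d) < 2d-1`):
  `percolationNobleEquationAt_nbwThresholdI_of_summable` (the NoBLE equations at `p_I` from `N`-summability there) and
  `nobleInitialInputsAt_of_prop45ii_identity` / `…_printed_identity` = `nobleInitialInputsAt_of_prop45ii(_printed)`
  (module `NobleInitialPoint`) with the binder `hEq` discharged — the initial-step oracle binder `NobleInitialInputsAt`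
  of `NobleInstantiate` from the hybrid Prop. 4.5(ii), Assumptions 4.1/4.3 at `p_I` and the weighted-diagram bounds at
  `p_I` ([NoBLE17] §3.3.3 / Prop. 2.11: the initialisation `f_i(z_I) ≤ γ_i` of the bootstrap).

## Proof (as in the paper, made explicit)

Level 0 (p. 25): partition `{v ↔ x through A}` by the LAST pivotal bond `(a,b)` for `v → x` with `E′(v,a;A)` (the
tree's `mem_connThrough_iff_laceE_or_cut`, read off `B`), apply the cutting lemma in `P^B` — for `{a,b} ∉ B` the bond
is independent of the rest, for `{a,b} ∈ B` the term vanishes — and rewrite the inner `P^B_1(b ↔ x off C̃)` as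
`P_1(b ↔ x off C̃ ∪ A′)` ((3.19)–(3.20): `occursOff_bondsAt_openConnIn_compl`, which is where `B(A′) ⊆ B ⊆ B({v} ∪ A′)`
enters) and then by (3.8)–(3.9) as `τ^{(a−b)}(x − b) − P^{B(a)}(b ↔ x through C̃ ∪ A′)` (`probOff_bondsAt_openConn_eq_add`
+ translation invariance `probOff_bondsAt_openConn_eq_ofReal_tauOff`); the bond sum is the sum over `u` and the `2d`
directions (`tsum_bondJ_mul`), the cell probabilities are `Ξ^{B,(0)}`, `Ψ^{B,(0),κ}` and the subtracted term is
`|R^B_0|` (3.25).  Level `n → n+1` (pp. 26–27): the innermost kernel `P^{B(w)}(w′ ↔ x through C ∪ {w})` of `|R^B_n|`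
satisfies THE SAME level-0 identity with outer data `(B(w), {w})` (`nobleKerThrough_add_nobleOpW`; here `w′ ≠ w`, which
holds on every cell since cells are indexed by lattice bonds — `nobleOp_congr_adj`), and the `n+1` outer nesting
operators are additive and commute with the `Σ_{(u,κ)} c_{u,κ}`-combination (`nobleOp_add`, `nobleIter_tsum_mul`,
`nobleOp_push`), giving `|R^B_n| + |R^B_{n+1}| = Ξ^{B,(n+1)} + Σ pΨ^{B,(n+1)}τ` in `[0,∞]`; all terms are finite for
`p < p_c` (`LaceExpansionNobleContinuity(Summed)`), so the identities telescope over `ℝ` with alternating signs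
(`toReal_eq_alternating_of_add`).  §3.3 exactly as printed (see "What is proved", §G–§H).  `M → ∞`: §I above.

## TYPING READINGS (recorded in the programme's DIVERGENCE.md as D-or13, D-or14)

(a) "the expectation is trivially zero for `b ∈ B`" (p. 26) is true for the three outer data the paper USES
(`B = ∅`; `(B(w), A′ = {w})` with start `v ≠ w`, the inner data of (3.26)/(3.50); `({b_ι}, ∅)` with `A = {e_ι} ∌ 0`, the
data of (3.51)) but NOT for every pair `(B, A′)` allowed by the wording of Lemma 3.3: for `B = B(A′)` with the start
`x ∈ A′ ∩ A` (or `B ⊆ B(x)` containing a bond at `x`, with `x ∈ A`) the cell of the bond `(x, u′)`, `u′ ∉ A′`, has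
`E′(x,x;A) = {x ∈ A}` = everything and `C̃^{(x,u′)}_0(x) = {x}` under `P^B`, so its term
`p P^{B(x)}(u′ ↔ y through {x} ∪ A′)` is in general positive.  The level-0 theorem therefore carries the explicit
hypothesis `hBc : ∀ u u′, s(u,u′) ∈ B → nobleCell B A′ A v u u′ = ∅` ("no degenerate cells"), discharged for the three
data above (`nobleCell_bondsAt_eq_empty_of_ne`, the `B = ∅` case, and the `({b_ι},∅,{e_ι})` case inside
`noble_iota_level_zero_eq`); the level recursion `n → n+1` needs no hypothesis.  Nothing printed is weakened: every
instance the paper applies is covered.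
(b) (2.15) is proved for `M ≥ 1` exactly as Proposition 2.1 states it ("`M ≥ 1`"); with the `N = 0` data (3.53)–(3.54)
alone (the tree's `nobleRIota e 0 = R^{b_ι}_0`) the `M = 0` analogue of (3.52) would miss the correction term
`−p𝔼^{b_ι}_0[𝟙{e_ι ∉ C̃} P^0_1(e_ι ↔^{C̃} x)]` of (3.49) and is not asserted.  (2.14) is proved for every `M ≥ 0`.  The sign
conventions are the tree's: `nobleR M = (−1)^{M+1}|R^∅_M|`, `nobleRIota e (M+1) = (−1)^{M}·(|R^{b_ι}_{M+1}| + p𝔼[𝟙|R^{B(0)}_M|])`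
as displayed in `nobleRIota_eq`, i.e. (3.33) and (3.57).
(c) The `M → ∞` statements take as hypotheses exactly the two `N`-summabilities `Summable (N ↦ Σ'_x Ξ^{(N)}_p(x))`,
`Summable (N ↦ Σ'_x Ξ^{(N),ι}_p(x))` — the paper obtains them from its Section 4 bounds inside the bootstrap; the tree
carries them as the `NSumLE` clauses of `NobleAssumption43At` — and derive every other convergence; no statement about
`p = p_c` is made.
-/

noncomputable section

namespace Literature.Probability.FitznerVanDerHofstad2017

open _root_.MeasureTheory Literature.Barriers.CriticalPhenomena Literature.Probability.Percolation
open Literature.Probability.LatticeModels Literature.Probability.Percolation.DCT16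
open scoped BigOperators ENNReal

variable {d : ℕ}

/-! ### A. Events read off a bond set: elementary identities -/

/-- `(ω ∖ {e})_{B^c} = ω_{B^c} ∖ {e}`. [folklore] -/
theorem offBonds_sdiff_singleton (B : Set (Sym2 (Site d))) (e : Sym2 (Site d)) (ω : BondConfig (Site d)) :
    offBonds B (ω \ {e}) = offBonds B ω \ {e} := by
  ext f
  simp only [offBonds_def, Set.mem_sdiff, Set.mem_singleton_iff]
  tauto

/-- `B(A)` is monotone in `A`. [folklore] -/
theorem bondsAt_mono {A A' : Set (Site d)} (h : A ⊆ A') : bondsAt A ⊆ bondsAt A' :=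
  fun _ ⟨y, hy, hye⟩ => ⟨y, h hy, hye⟩

/-- An event determined by the bonds of `K` stays so when read off `B`. [folklore] -/
theorem determinedBy_occursOff (B : Set (Sym2 (Site d))) {E : Set (BondConfig (Site d))} {K : Set (Sym2 (Site d))}
    (hE : DeterminedBy E K) : DeterminedBy (occursOff B E) K := by
  rw [determinedBy_iff] at hE ⊢
  intro ω ω' h
  rw [mem_occursOff_iff, mem_occursOff_iff]
  refine hE _ _ ?_
  have h' : ∀ χ : BondConfig (Site d), offBonds B χ ∩ K = (χ ∩ K) \ B := fun χ => by
    ext f; simp only [offBonds_def, Set.mem_inter_iff, Set.mem_sdiff]; tauto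
  rw [h', h', h]

/-- `{∅ occurs off B} = ∅`. [folklore] -/
theorem occursOff_emptyset (B : Set (Sym2 (Site d))) : occursOff B (∅ : Set (BondConfig (Site d))) = ∅ := rfl

/-- On `E′(v,u;A)` with `u′ ∉ C̃^{(u,u′)}(v)`, the endpoint `u` lies in `C̃^{(u,u′)}(v)`: an open path
`v → u` leaving `C̃` would have to use the bond `{u,u′}` from inside. [cite: HeydenreichVanDerHofstad2017, Lemma 6.4 (proof)] -/
theorem mem_restrCluster_of_mem_laceE {χ : BondConfig (Site d)} {A : Set (Site d)} {v u u' : Site d}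
    (hl : χ ∈ laceE A v u) (hu' : u' ∉ restrCluster u u' v χ) : u ∈ restrCluster u u' v χ := by
  by_contra hu
  have hvu : PathIn (openGraph χ) Set.univ v u :=
    pathIn_univ_iff_reachable.2 (connThrough_subset_openConn A v u (connThrough_of_mem_laceE hl))
  obtain ⟨c, c', hc, hc', -, hadj', -⟩ := hvu.exit (self_mem_restrCluster u u' v χ) hu
  rcases Sym2.eq_iff.1 (edge_eq_of_adj_of_mem_restrCluster hc hc' hadj') with ⟨h3, -⟩ | ⟨h3, -⟩
  · exact hu (h3 ▸ hc)
  · exact hu' (h3 ▸ hc)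

/-- **(3.19)–(3.20) as an identity of events.** For outer data `(B, A′)` with `B(A′) ⊆ B ⊆ B(S ∪ A′)` and a
vertex `u′ ∉ A′`: `{u′ ↔ x in ℤᵈ ∖ S, read off B} = {u′ ↔ x in ℤᵈ ∖ (S ∪ A′)}` — an open path avoiding
`S ∪ A′` uses no bond of `B`, and an open path off `B ⊇ B(A′)` cannot enter `A′`.
[cite: FitznerVanDerHofstad2017, (3.19)–(3.20) (arXiv:1506.07977v2 p. 25: "as x ∈ C̃^b(x), B ⊂ C̃^b(x) ∪ A′, so that P₁^B(b̄ ↔ y off C̃^b(x) ∪ A′) = P₁(b̄ ↔ y off C̃^b(x) ∪ A′)")] -/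
theorem occursOff_openConnIn_compl_eq {B : Set (Sym2 (Site d))} {A' S : Set (Site d)}
    (hBa : bondsAt A' ⊆ B) (hBb : B ⊆ bondsAt (S ∪ A')) {u' : Site d} (hu' : u' ∉ A') (x : Site d) :
    occursOff B (openConnIn Sᶜ u' x) = openConnIn (S ∪ A')ᶜ u' x := by
  ext ω
  rw [mem_occursOff_iff, mem_openConnIn_iff_pathIn, mem_openConnIn_iff_pathIn]
  constructor
  · intro h
    refine pathIn_induction (fun w => PathIn (openGraph ω) (S ∪ A')ᶜ u' w) h (PathIn.refl ?_) ?_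
    · simp only [Set.mem_compl_iff, Set.mem_union, not_or]
      exact ⟨h.left_mem, hu'⟩
    · intro a b _ hb hPa hab
      rw [openGraph_adj, offBonds_def] at hab
      obtain ⟨⟨habω, habB⟩, hne⟩ := hab
      have hbA' : b ∉ A' := fun hbA' => habB (hBa ⟨b, hbA', Sym2.mem_mk_right a b⟩)
      refine hPa.tail ((openGraph_adj ω a b).2 ⟨habω, hne⟩) ?_
      simp only [Set.mem_compl_iff, Set.mem_union, not_or]
      exact ⟨hb, hbA'⟩
  · intro h
    have h' : PathIn (openGraph (offBonds B ω)) (S ∪ A')ᶜ u' x := by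
      refine pathIn_congrGraph (fun a b ha hb hab => ?_) h
      rw [openGraph_adj] at hab ⊢
      refine ⟨?_, hab.2⟩
      rw [offBonds_def]
      refine ⟨hab.1, fun hB => ?_⟩
      obtain ⟨y, hy, hye⟩ := hBb hB
      rcases Sym2.mem_iff.1 hye with rfl | rfl
      · exact ha hy
      · exact hb hy
    exact h'.mono (Set.compl_subset_compl.2 Set.subset_union_left)

/-- Removing the bonds at a vertex `u ∈ T` does not affect `{u′ ↔ x in ℤᵈ ∖ T}`. [folklore] -/
theorem occursOff_bondsAt_openConnIn_compl {T : Set (Site d)} {u : Site d} (hu : u ∈ T) (u' x : Site d) :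
    occursOff (bondsAt {u}) (openConnIn Tᶜ u' x) = openConnIn Tᶜ u' x := by
  ext ω
  rw [mem_occursOff_iff]
  have hdet := determinedBy_openConnIn Tᶜ u' x (K := (Tᶜ).sym2) le_rfl
  rw [determinedBy_iff] at hdet
  refine hdet _ _ ?_
  ext e
  simp only [offBonds_def, Set.mem_inter_iff, Set.mem_sdiff, mem_bondsAt_singleton_iff]
  constructor
  · rintro ⟨⟨he, -⟩, hK⟩
    exact ⟨he, hK⟩
  · rintro ⟨he, hK⟩
    exact ⟨⟨he, fun hue => (Set.mem_sym2_iff_subset.1 hK hue) hu⟩, hK⟩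

/-- **(3.9)/(3.21) in measure form**: for `u ∈ T`,
`P^{B(u)}(u′ ↔ x) = P(u′ ↔ x in ℤᵈ ∖ T) + P^{B(u)}(u′ ↔ x through T)`
(`{u′ ↔ x through T} = {u′ ↔ x} ∖ {u′ ↔ x in ℤᵈ ∖ T}`, the latter event not seeing the bonds at `u ∈ T`).
[cite: FitznerVanDerHofstad2017, (3.8)–(3.9) (arXiv:1506.07977v2 p. 22), (3.21)–(3.22) (p. 25)] -/
theorem probOff_bondsAt_openConn_eq_add (p : unitInterval) {T : Set (Site d)} {u : Site d} (hu : u ∈ T)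
    (u' x : Site d) :
    probOff d p (bondsAt {u}) (openConn u' x) =
      bondPercolation (zdGraph d) p (openConnIn Tᶜ u' x) + nobleKerThrough d p u T u' x := by
  rw [nobleKerThrough_apply, probOff_def, probOff_def, ← occursOff_bondsAt_openConnIn_compl hu u' x]
  have hsub : openConnIn Tᶜ u' x ⊆ (openConn u' x : Set (BondConfig (Site d))) := openConnIn_subset_openConn _ u' x
  have hunion : occursOff (bondsAt {u}) (openConn u' x) =
      occursOff (bondsAt {u}) (connThrough T u' x) ∪ occursOff (bondsAt {u}) (openConnIn Tᶜ u' x) := by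
    ext ω
    simp only [mem_occursOff_iff, Set.mem_union, mem_connThrough_iff]
    constructor
    · intro h
      by_cases h' : offBonds (bondsAt {u}) ω ∈ openConnIn Tᶜ u' x
      · exact Or.inr h'
      · exact Or.inl ⟨h, h'⟩
    · rintro (⟨h, -⟩ | h)
      · exact h
      · exact hsub h
  rw [hunion, measure_union _ (measurableSet_occursOff _ (measurableSet_openConnIn_set _ u' x)), add_comm]
  exact Set.disjoint_left.2 fun ω h1 h2 => ((mem_connThrough_iff _ _ _ _).1 h1).2 h2

/-- **The innermost step (3.21) + (3.5)**: for `u ∈ T`,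
`τ^{(u-u′)}(x-u′) = P(u′ ↔ x in ℤᵈ ∖ T) + P^{B(u)}(u′ ↔ x through T)` (translation `P^{B(u)}(u′ ↔ x) =
τ^{(u-u′)}(x - u′)`). [cite: FitznerVanDerHofstad2017, (3.21)–(3.22) (arXiv:1506.07977v2 p. 25), (3.5) (p. 22)] -/
theorem ofReal_tauOff_eq_add (p : unitInterval) {T : Set (Site d)} {u : Site d} (hu : u ∈ T) (u' x : Site d) :
    ENNReal.ofReal (tauOff d p (u - u') (x - u')) =
      bondPercolation (zdGraph d) p (openConnIn Tᶜ u' x) + nobleKerThrough d p u T u' x := by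
  rw [← probOff_bondsAt_openConn_eq_ofReal_tauOff, ← probOff_bondsAt_openConn_shift,
    probOff_bondsAt_openConn_eq_add p hu]

/-! ### B. The cutting-bond lemma read off `B` (Lemma 3.5 in the measure `P^B`) -/

section Zd

variable {p : unitInterval}

/-- **Lemma 6.5 / cutting-bond partition, read off `B`**:
`P^B(v ↔ x through A) = P^B(E′(v,x;A)) + Σ_{(a,b)} P^B({(a,b) open} ∩ {(a,b) pivotal for v → x} ∩ E′(v,a;A))`.
[cite: FitznerVanDerHofstad2017, (3.15)–(3.16) (arXiv:1506.07977v2 p. 24)] [cite: HeydenreichVanDerHofstad2017, Lemma 6.5 and (6.2.22)] -/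
theorem probOff_connThrough_eq_laceE_add_tsum (p : unitInterval) (B : Set (Sym2 (Site d))) (A : Set (Site d))
    (v x : Site d) :
    probOff d p B (connThrough A v x) = probOff d p B (laceE A v x) +
      ∑' q : Site d × Site d, probOff d p B
        ({ω | s(q.1, q.2) ∈ ω} ∩ {ω | IsPivotalBond ω v x q.1 q.2} ∩ laceE A v q.1) := by
  have hset : connThrough A v x = laceE A v x ∪
      ⋃ q : Site d × Site d, ({ω | s(q.1, q.2) ∈ ω} ∩ {ω | IsPivotalBond ω v x q.1 q.2} ∩ laceE A v q.1) := by
    ext ω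
    rw [mem_connThrough_iff_laceE_or_cut, Set.mem_union, Set.mem_iUnion]
    refine or_congr_right ⟨?_, ?_⟩
    · rintro ⟨a, b, hab, hp, hl⟩
      exact ⟨(a, b), ⟨hab, hp⟩, hl⟩
    · rintro ⟨q, ⟨hab, hp⟩, hl⟩
      exact ⟨q.1, q.2, hab, hp, hl⟩
  have hdisj1 : Disjoint (laceE A v x)
      (⋃ q : Site d × Site d, ({ω | s(q.1, q.2) ∈ ω} ∩ {ω | IsPivotalBond ω v x q.1 q.2} ∩ laceE A v q.1)) := by
    rw [Set.disjoint_iUnion_right]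
    intro q
    rw [Set.disjoint_left]
    rintro ω hE ⟨⟨-, hp⟩, hl⟩
    exact not_laceE_of_cut hp hl hE
  have hdisj2 : Pairwise (Function.onFun Disjoint fun q : Site d × Site d =>
      ({ω | s(q.1, q.2) ∈ ω} ∩ {ω | IsPivotalBond ω v x q.1 q.2} ∩ laceE A v q.1)) := by
    intro q q' hne
    rw [Function.onFun, Set.disjoint_left]
    rintro ω ⟨⟨hab, hp⟩, hl⟩ ⟨⟨-, hp'⟩, hl'⟩
    have hvx : ω ∈ openConn v x := connThrough_subset_openConn A v x (connThrough_of_cut hab hp hl)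
    obtain ⟨h1, h2⟩ := cuttingBond_unique hvx hp hl hp' hl'
    exact hne (Prod.ext h1 h2)
  have hmeas : ∀ q : Site d × Site d, MeasurableSet
      ({ω | s(q.1, q.2) ∈ ω} ∩ {ω | IsPivotalBond ω v x q.1 q.2} ∩ laceE A v q.1) := fun q =>
    ((measurableSet_mem _).inter (measurableSet_isPivotalBond v x q.1 q.2)).inter
      (measurableSet_laceE A v q.1)
  simp only [probOff_def, occursOff]
  have hdisj1' : Disjoint (offBonds B ⁻¹' laceE A v x) (⋃ q : Site d × Site d, offBonds B ⁻¹'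
      ({ω | s(q.1, q.2) ∈ ω} ∩ {ω | IsPivotalBond ω v x q.1 q.2} ∩ laceE A v q.1)) := by
    rw [← Set.preimage_iUnion]
    exact Disjoint.preimage (offBonds B) hdisj1
  rw [hset, Set.preimage_union, Set.preimage_iUnion,
    measure_union hdisj1' (MeasurableSet.iUnion fun q => measurable_offBonds B (hmeas q)),
    measure_iUnion (hdisj2.mono fun q q' h => Disjoint.preimage (offBonds B) h)
      fun q => measurable_offBonds B (hmeas q)]

open Classical in
/-- **Conditioning on the restricted cluster, read off `B`** ((3.19)–(3.20)): for `p < p_c` and a bond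
`{a,b}` of `ℤᵈ`,
`P(ω ∖ {a,b} ∈ {{(a,b) pivotal for v → x} ∩ E′(v,a;A) off B}) = 𝔼[𝟙{E′(v,a;A) off B} P({b ↔ x in ℤᵈ ∖ C̃^{(a,b)}(v)(ω_{B^c})} off B)]`
— the cell `{E′ off B} ∩ {C̃(ω_{B^c}) = S}` is determined by the bonds touching `S`, the outside event
`{{b ↔ x in ℤᵈ ∖ S} off B}` by the bonds inside `ℤᵈ ∖ S`.
[cite: FitznerVanDerHofstad2017, Lemma 3.5 (3.17) and (3.18) (arXiv:1506.07977v2 p. 24), (3.19)–(3.20) (p. 25)] [cite: HeydenreichVanDerHofstad2017, Lemma 6.4 (proof, (6.2.15)–(6.2.17))] -/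
theorem measure_preimage_occursOff_pivotal_laceE (hp : (p : ℝ) < criticalProb (zdGraph d) (0 : Site d))
    {a b : Site d} (hadj : (zdGraph d).Adj a b) (B : Set (Sym2 (Site d))) (A : Set (Site d)) (v x : Site d) :
    bondPercolation (zdGraph d) p
        ((fun ω => ω \ {s(a, b)}) ⁻¹' occursOff B ({ω | IsPivotalBond ω v x a b} ∩ laceE A v a)) =
      ∫⁻ ω, (occursOff B (laceE A v a)).indicator
        (fun ω => bondPercolation (zdGraph d) p
          (occursOff B (openConnIn (restrCluster a b v (offBonds B ω))ᶜ b x))) ω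
          ∂(bondPercolation (zdGraph d) p) := by
  -- the restricted cluster read off `B`
  set C : BondConfig (Site d) → Set (Site d) := fun ω => restrCluster a b v (offBonds B ω) with hC
  have hCe : ∀ ω, restrCluster a b v (offBonds B ω \ {s(a, b)}) = C ω := fun ω => by
    rw [hC]; exact restrCluster_offBonds_self a b v (offBonds B ω)
  -- the statistic `Ψ = C̃(ω_{B^c})` (as a finset; junk `∅` on the null set where it is infinite)
  set Ψ : BondConfig (Site d) → Finset (Site d) :=
    fun ω => if h : (C ω).Finite then h.toFinset else ∅ with hΨ
  set A₀ : Set (BondConfig (Site d)) :=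
    {ω | a ∈ C ω ∧ offBonds B ω \ {s(a, b)} ∈ laceE A v a ∧ (C ω).Finite} with hA₀
  set E : Finset (Site d) → Set (BondConfig (Site d)) :=
    fun S => occursOff B (openConnIn ((↑S : Set (Site d))ᶜ) b x) with hE
  have hN0 : bondPercolation (zdGraph d) p {ω | (C ω).Infinite} = 0 :=
    measure_mono_null (fun ω hω => Set.Infinite.mono
      ((openCluster_mono Set.sdiff_subset v).trans (openCluster_mono (offBonds_subset B ω) v)) hω)
      (measure_percolatesAt_eq_zero_of_lt hp v)
  have hΨfin : ∀ ω, (C ω).Finite → (↑(Ψ ω) : Set (Site d)) = C ω := by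
    intro ω h
    simp only [hΨ, dif_pos h, Set.Finite.coe_toFinset]
  -- (i) the event off the null set
  have hF : (fun ω => ω \ {s(a, b)}) ⁻¹' occursOff B ({ω | IsPivotalBond ω v x a b} ∩ laceE A v a) \
        {ω | (C ω).Infinite} = A₀ ∩ {ω | ω ∈ E (Ψ ω)} := by
    ext ω
    simp only [Set.mem_sdiff, Set.mem_preimage, mem_occursOff_iff, Set.mem_inter_iff, Set.mem_setOf_eq,
      Set.not_infinite, hA₀, hE, offBonds_sdiff_singleton]
    constructor
    · rintro ⟨⟨hpiv, hl⟩, hfin⟩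
      rw [isPivotalBond_sdiff_self_iff] at hpiv
      obtain ⟨-, ha, hbx⟩ := hpiv
      refine ⟨⟨ha, hl, hfin⟩, ?_⟩
      rw [hΨfin ω hfin]
      exact hbx
    · rintro ⟨⟨ha, hl, hfin⟩, hbx⟩
      rw [hΨfin ω hfin] at hbx
      exact ⟨⟨(isPivotalBond_sdiff_self_iff _ v x a b).2 ⟨hadj, ha, hbx⟩, hl⟩, hfin⟩
  -- (ii) the pieces of the data partition
  have hpiece : ∀ S : Finset (Site d), A₀ ∩ Ψ ⁻¹' {S} =
      {_ω | a ∈ (S : Set (Site d))} ∩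
        (fun ω => ω \ {s(a, b)}) ⁻¹' occursOff B (laceE A v a ∩ clusterIs v S) := by
    intro S
    ext ω
    simp only [Set.mem_inter_iff, Set.mem_preimage, Set.mem_singleton_iff, Set.mem_setOf_eq, hA₀,
      mem_clusterIs, mem_occursOff_iff, offBonds_sdiff_singleton]
    have hCω : C ω = openCluster (offBonds B ω \ {s(a, b)}) v := rfl
    constructor
    · rintro ⟨⟨ha, hl, hfin⟩, hS⟩
      have hC' : C ω = ↑S := by rw [← hΨfin ω hfin, hS]
      exact ⟨hC' ▸ ha, hl, hCω ▸ hC'⟩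
    · rintro ⟨ha, hl, hC'⟩
      have hC'' : C ω = ↑S := hCω ▸ hC'
      have hfin : (C ω).Finite := hC'' ▸ S.finite_toSet
      refine ⟨⟨hC'' ▸ ha, hl, hfin⟩, ?_⟩
      apply Finset.coe_injective
      rw [hΨfin ω hfin, hC'']
  have hdet : ∀ S, DeterminedBy (A₀ ∩ Ψ ⁻¹' {S}) (edgesTouching (↑S : Set (Site d))) := by
    intro S
    rw [hpiece S]
    exact (determinedBy_setOf_const _ _).inter (determinedBy_preimage_sdiff_singleton _
      (determinedBy_occursOff B (determinedBy_laceE_inter_clusterIs A v a S)))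
  have hmeas : ∀ S, MeasurableSet (A₀ ∩ Ψ ⁻¹' {S}) := by
    intro S
    rw [hpiece S]
    exact (MeasurableSet.const _).inter (measurable_sdiff_singleton _
      (measurableSet_occursOff B ((measurableSet_laceE A v a).inter (measurableSet_clusterIs v S))))
  have hEdet : ∀ S, DeterminedBy (E S) (((↑S : Set (Site d))ᶜ).sym2) := fun S =>
    determinedBy_occursOff B (determinedBy_openConnIn _ b x le_rfl)
  have hEm : ∀ S, MeasurableSet (E S) := fun S =>
    measurableSet_occursOff B (measurableSet_openConnIn_set _ b x)
  have hdisj : ∀ ω ∈ A₀, Disjoint (edgesTouching (↑(Ψ ω) : Set (Site d))) (((↑(Ψ ω) : Set (Site d))ᶜ).sym2) :=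
    fun ω _ => disjoint_edgesTouching_compl_sym2 _
  have hsum := bondPercolation_inter_memDep_eq_tsum (zdGraph d) p
    (fun S : Finset (Site d) => edgesTouching (↑S : Set (Site d)))
    (fun S : Finset (Site d) => ((↑S : Set (Site d))ᶜ).sym2) Ψ E hdet hmeas hEdet hEm hdisj
  -- (iii) assemble
  calc bondPercolation (zdGraph d) p
        ((fun ω => ω \ {s(a, b)}) ⁻¹' occursOff B ({ω | IsPivotalBond ω v x a b} ∩ laceE A v a))
      = bondPercolation (zdGraph d) p
          ((fun ω => ω \ {s(a, b)}) ⁻¹' occursOff B ({ω | IsPivotalBond ω v x a b} ∩ laceE A v a) \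
          {ω | (C ω).Infinite}) := (measure_sdiff_null hN0).symm
    _ = bondPercolation (zdGraph d) p (A₀ ∩ {ω | ω ∈ E (Ψ ω)}) := by rw [hF]
    _ = ∑' S, bondPercolation (zdGraph d) p (A₀ ∩ Ψ ⁻¹' {S}) * bondPercolation (zdGraph d) p (E S) := hsum
    _ = ∫⁻ ω, A₀.indicator (fun ω => bondPercolation (zdGraph d) p (E (Ψ ω))) ω ∂(bondPercolation (zdGraph d) p) :=
        (lintegral_indicator_comp_eq_tsum _ Ψ (fun S => bondPercolation (zdGraph d) p (E S)) hmeas).symm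
    _ = _ := by
        refine lintegral_congr_ae ?_
        filter_upwards [measure_eq_zero_iff_ae_notMem.1 hN0] with ω hω
        have hfin : (C ω).Finite := Set.not_infinite.1 hω
        simp only [Set.indicator_apply, hE]
        rw [hΨfin ω hfin]
        by_cases hbC : b ∈ C ω
        · rw [show openConnIn (C ω)ᶜ b x = ∅ from openConnIn_compl_eq_empty_of_mem hbC x,
            occursOff_emptyset, measure_empty, ite_self, ite_self]
        · by_cases haC : a ∈ C ω
          · have hiff : ω ∈ A₀ ↔ ω ∈ occursOff B (laceE A v a) := by
              simp only [hA₀, Set.mem_setOf_eq, mem_occursOff_iff]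
              rw [laceE_sdiff_iff haC hbC]
              exact ⟨fun h => h.2.1, fun h => ⟨haC, h, hfin⟩⟩
            rw [if_congr hiff rfl rfl]
          · have h1 : ω ∉ A₀ := by
              simp only [hA₀, Set.mem_setOf_eq]
              exact fun h => haC h.1
            have h2 : ω ∉ occursOff B (laceE A v a) := by
              intro hl
              rw [mem_occursOff_iff] at hl
              have hva : PathIn (openGraph (offBonds B ω)) Set.univ v a :=
                pathIn_univ_iff_reachable.2
                  (connThrough_subset_openConn A v a (connThrough_of_mem_laceE hl))
              obtain ⟨c, c', hc, hc', -, hadj', -⟩ :=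
                hva.exit (self_mem_restrCluster a b v (offBonds B ω)) haC
              rcases Sym2.eq_iff.1 (edge_eq_of_adj_of_mem_restrCluster hc hc' hadj') with
                ⟨h3, -⟩ | ⟨h3, -⟩
              · exact haC (h3 ▸ hc)
              · exact hbC (h3 ▸ hc)
            rw [if_neg h1, if_neg h2]

open Classical in
/-- **Lemma 3.5 (the cutting-bond lemma) in the measure `P^B`**: for `p < p_c` and a bond `{a,b}` of `ℤᵈ`,
`P^B(E′(v,a;A) ∩ {(a,b) occupied and pivotal for v → x})`
`= 𝟙{{a,b} ∉ B} · p · 𝔼[𝟙{E′(v,a;A) off B} · P({b ↔ x in ℤᵈ ∖ C̃^{(a,b)}(v)(ω_{B^c})} off B)]`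
(under `P^B` a bond of `B` is never occupied; for `{a,b} ∉ B` its state is independent of the rest).
[cite: FitznerVanDerHofstad2017, Lemma 3.5 (3.17)–(3.18) (arXiv:1506.07977v2 p. 24) and (3.19) (p. 25); Lemma 3.3 proof ("the expectation is trivially zero for b ∈ B", p. 26)] -/
theorem probOff_cut_eq (hp : (p : ℝ) < criticalProb (zdGraph d) (0 : Site d)) {a b : Site d}
    (hadj : (zdGraph d).Adj a b) (B : Set (Sym2 (Site d))) (A : Set (Site d)) (v x : Site d) :
    probOff d p B ({ω | s(a, b) ∈ ω} ∩ {ω | IsPivotalBond ω v x a b} ∩ laceE A v a) =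
      if s(a, b) ∈ B then 0 else ENNReal.ofReal p * ∫⁻ ω, (occursOff B (laceE A v a)).indicator
        (fun ω => bondPercolation (zdGraph d) p
          (occursOff B (openConnIn (restrCluster a b v (offBonds B ω))ᶜ b x))) ω
          ∂(bondPercolation (zdGraph d) p) := by
  rw [probOff_def, cut_eq_inter_preimage A v x a b]
  have hocc : occursOff B ({ω : BondConfig (Site d) | s(a, b) ∈ ω} ∩
      (fun ω => ω \ {s(a, b)}) ⁻¹' ({ω | IsPivotalBond ω v x a b} ∩ laceE A v a)) =
      ({ω | s(a, b) ∈ ω} ∩ {_ω | s(a, b) ∉ B}) ∩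
        (fun ω => ω \ {s(a, b)}) ⁻¹' occursOff B ({ω | IsPivotalBond ω v x a b} ∩ laceE A v a) := by
    ext ω
    simp only [mem_occursOff_iff, Set.mem_inter_iff, Set.mem_setOf_eq, Set.mem_preimage,
      offBonds_sdiff_singleton]
    rw [offBonds_def, Set.mem_sdiff]
  rw [hocc]
  by_cases he : s(a, b) ∈ B
  · rw [if_pos he]
    have h0 : ({ω : BondConfig (Site d) | s(a, b) ∈ ω} ∩ {_ω | s(a, b) ∉ B}) = ∅ :=
      Set.eq_empty_of_forall_notMem fun ω h => h.2 he
    rw [h0, Set.empty_inter, measure_empty]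
  · rw [if_neg he]
    have h1 : ({ω : BondConfig (Site d) | s(a, b) ∈ ω} ∩ {_ω | s(a, b) ∉ B}) = {ω | s(a, b) ∈ ω} :=
      Set.inter_eq_left.2 fun _ _ => he
    rw [h1, measure_mem_inter_preimage_sdiff p (s(a, b)) (measurableSet_occursOff B
        ((measurableSet_isPivotalBond v x a b).inter (measurableSet_laceE A v a))),
      measure_setOf_mem_edge p ((SimpleGraph.mem_edgeSet _).2 hadj),
      measure_preimage_occursOff_pivotal_laceE hp hadj B A v x]

end Zd

/-! ### C. Additivity of the nesting operator; dependence on adjacent pairs only -/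

/-- **Additivity of `𝒩^{B,A′}`** in the inner kernel (for a measurable first summand).
[cite: FitznerVanDerHofstad2017, (3.26)–(3.30) (arXiv:1506.07977v2 p. 26: "We insert (3.26) into R^B_0(x,y;A) and obtain (3.10) for M = 1")] -/
theorem nobleOp_add (p : unitInterval) (B : Set (Sym2 (Site d))) (A' : Set (Site d)) {h₁ h₂ : NobleKernel d}
    (hh₁ : NobleKernelMeasurable h₁) (A : Set (Site d)) (v x : Site d) :
    nobleOp d p B A' (fun w A v x => h₁ w A v x + h₂ w A v x) A v x =
      nobleOp d p B A' h₁ A v x + nobleOp d p B A' h₂ A v x := by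
  rw [nobleOp_apply, nobleOp_apply, nobleOp_apply, ← ENNReal.tsum_add]
  refine tsum_congr fun b => ?_
  rw [← mul_add, ← lintegral_add_left (measurable_nobleIntegrand hh₁ B A' A v x b.1 b.2)]
  congr 1
  refine lintegral_congr fun ω => ?_
  by_cases hω : ω ∈ nobleCell B A' A v b.1 b.2
  · simp only [Set.indicator_of_mem hω]
  · simp only [Set.indicator_of_notMem hω, add_zero]

/-- The nesting operator evaluates the inner kernel only at lattice bonds `(u,u′)`: kernels agreeing at
adjacent pairs have the same image. [cite: FitznerVanDerHofstad2017, (3.22), (3.26) (arXiv:1506.07977v2 pp. 25–26: the bond sums `Σ_b p 𝔼[…]`)] -/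
theorem nobleOp_congr_adj (p : unitInterval) (B : Set (Sym2 (Site d))) (A' : Set (Site d)) {h₁ h₂ : NobleKernel d}
    (h : ∀ u u', (zdGraph d).Adj u u' → ∀ A x, h₁ u A u' x = h₂ u A u' x) (A : Set (Site d)) (v x : Site d) :
    nobleOp d p B A' h₁ A v x = nobleOp d p B A' h₂ A v x := by
  rw [nobleOp_apply, nobleOp_apply]
  refine tsum_congr fun b => ?_
  by_cases hadj : (zdGraph d).Adj b.1 b.2
  · congr 1
    refine lintegral_congr fun ω => ?_
    by_cases hω : ω ∈ nobleCell B A' A v b.1 b.2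
    · rw [Set.indicator_of_mem hω, Set.indicator_of_mem hω, h _ _ hadj]
    · rw [Set.indicator_of_notMem hω, Set.indicator_of_notMem hω]
  · rw [bondJ_sub, if_neg hadj, ENNReal.ofReal_zero, zero_mul, zero_mul]

/-- **The transfer coefficients** `c_{(u,κ)}(x) = p · τ^κ(x - u + e_κ)` of the `Ψ`-terms of (3.10) / (2.16),
indexed by the directed bond `(u, u - e_κ)`. [cite: FitznerVanDerHofstad2017, (3.10) (arXiv:1506.07977v2 p. 23), (3.35) (p. 27)] -/
def nobleTC (d : ℕ) (p : unitInterval) (i : Site d × (Fin d × Bool)) (x : Site d) : ℝ≥0∞ :=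
  ENNReal.ofReal p * ENNReal.ofReal (tauOff d p (Percolation.stepVec i.2) (x - i.1 + Percolation.stepVec i.2))

/-- Unfolding lemma. [folklore] -/
theorem nobleTC_def (p : unitInterval) (i : Site d × (Fin d × Bool)) (x : Site d) :
    nobleTC d p i x = ENNReal.ofReal p *
      ENNReal.ofReal (tauOff d p (Percolation.stepVec i.2) (x - i.1 + Percolation.stepVec i.2)) := rfl

/-- `Σ_{(u,κ)} c_{(u,κ)}(x) F^κ(u) = Σ_u Σ_κ p F^κ(u) τ^κ(x-u+e_κ)`. [folklore] -/
theorem tsum_nobleTC_mul (p : unitInterval) (F : Site d → Site d → ℝ≥0∞) (x : Site d) :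
    ∑' i : Site d × (Fin d × Bool), nobleTC d p i x * F (Percolation.stepVec i.2) i.1 =
      ∑' u, ∑ κ : Fin d × Bool, ENNReal.ofReal p * F (Percolation.stepVec κ) u *
        ENNReal.ofReal (tauOff d p (Percolation.stepVec κ) (x - u + Percolation.stepVec κ)) := by
  rw [ENNReal.tsum_prod']
  refine tsum_congr fun u => ?_
  rw [tsum_fintype]
  refine Finset.sum_congr rfl fun κ _ => ?_
  rw [nobleTC_def, mul_right_comm]

/-- **Pushing a one-step identity through a nesting level.** If measurable kernels satisfy
`k₁ + k₂ = k₃ + Σ_i c_i(x) k₄ⁱ(…, i.1)` at all ADJACENT arguments `(u, ·, u′, ·)`, then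
`𝒩k₁ + 𝒩k₂ = 𝒩k₃ + Σ_i c_i(x) (𝒩k₄ⁱ)(…, i.1)` for every outer datum `(B, A′)` (additivity, σ-additivity and
the fact that the coefficients depend on the last argument only).
[cite: FitznerVanDerHofstad2017, (3.26)–(3.30) (arXiv:1506.07977v2 p. 26: "We now repeat using (3.26) recursively, for P^{b̲_M}_{M+1}(b̄_M ↔ y through C̃_M) (3.30) that appears in the remainder term R^B_M(x,y;A)")] -/
theorem nobleOp_push (p : unitInterval) (B : Set (Sym2 (Site d))) (A' : Set (Site d))
    {k₁ k₂ k₃ : NobleKernel d} {k₄ : Site d × (Fin d × Bool) → NobleKernel d}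
    (hk₁ : NobleKernelMeasurable k₁) (hk₃ : NobleKernelMeasurable k₃) (hk₄ : ∀ i, NobleKernelMeasurable (k₄ i))
    (hid : ∀ u u', (zdGraph d).Adj u u' → ∀ A x,
      k₁ u A u' x + k₂ u A u' x = k₃ u A u' x + ∑' i, nobleTC d p i x * k₄ i u A u' i.1)
    (A : Set (Site d)) (v x : Site d) :
    nobleOp d p B A' k₁ A v x + nobleOp d p B A' k₂ A v x =
      nobleOp d p B A' k₃ A v x + ∑' i, nobleTC d p i x * nobleOp d p B A' (k₄ i) A v i.1 := by
  have hk₄' : ∀ i, NobleKernelMeasurable (fun w A v _ => k₄ i w A v i.1 : NobleKernel d) :=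
    fun i w v _ => hk₄ i w v i.1
  calc nobleOp d p B A' k₁ A v x + nobleOp d p B A' k₂ A v x
      = nobleOp d p B A' (fun w A v x => k₁ w A v x + k₂ w A v x) A v x := (nobleOp_add p B A' hk₁ A v x).symm
    _ = nobleOp d p B A' (fun w A v x => k₃ w A v x + ∑' i, nobleTC d p i x * k₄ i w A v i.1) A v x :=
        nobleOp_congr_adj p B A' (fun u u' hadj A x => hid u u' hadj A x) A v x
    _ = nobleOp d p B A' k₃ A v x +
          nobleOp d p B A' (fun w A v x' => ∑' i, nobleTC d p i x' * k₄ i w A v i.1) A v x :=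
        nobleOp_add p B A' hk₃ A v x
    _ = nobleOp d p B A' k₃ A v x +
          nobleOp d p B A' (fun w A v _ => ∑' i, nobleTC d p i x *
            (fun w A v _ => k₄ i w A v i.1 : NobleKernel d) w A v x) A v x := by
        rw [nobleOp_congr_last p B A' (h₁ := fun w A v x' => ∑' i, nobleTC d p i x' * k₄ i w A v i.1)
          (h₂ := fun w A v _ => ∑' i, nobleTC d p i x * (fun w A v _ => k₄ i w A v i.1 : NobleKernel d) w A v x)
          (x₁ := x) (x₂ := x) (fun w A v => rfl) A v]
    _ = nobleOp d p B A' k₃ A v x +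
          ∑' i, nobleTC d p i x * nobleOp d p B A' (fun w A v _ => k₄ i w A v i.1) A v x := by
        rw [nobleOp_tsum_mul p B A' (fun i => nobleTC d p i x) hk₄' A v x]
    _ = _ := rfl

/-! ### D. The level-0 identity (3.18)–(3.25) for general outer data -/

/-- **Degenerate inner cells are empty**: for the inner data `(B(w), {w})` and a start `v ≠ w`, no cell uses a
bond containing `w` (`u = w`: `v ↔ w` off `B(w)` forces `v = w`; `u′ = w`: the cut-indicator vanishes).
[cite: FitznerVanDerHofstad2017, (3.26) (arXiv:1506.07977v2 p. 26: "To derive this rewrite first add the restriction b̄₁ ≠ b̲, after which we can remove the restriction b₁ ∉ B(b̲) since otherwise the summand is trivially zero")] -/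
theorem nobleCell_bondsAt_eq_empty_of_ne {w v : Site d} (hvw : v ≠ w) (A : Set (Site d)) {u u' : Site d}
    (hb : s(u, u') ∈ bondsAt {w}) : nobleCell (bondsAt {w}) {w} A v u u' = ∅ := by
  rw [Set.eq_empty_iff_forall_notMem]
  intro ω hω
  rw [mem_nobleCell_iff] at hω
  rw [mem_bondsAt_singleton_iff, Sym2.mem_iff] at hb
  rcases hb with rfl | rfl
  · exact hvw (eq_of_reachable_offBonds_bondsAt ((laceE_subset_openConn A v _ hω.1).symm))
  · exact hω.2 (Or.inr rfl)

open Classical in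
/-- `Ψ^{B,(0),κ}(v,u;A) = 𝟙{(u,u-e_κ) ∉ B} · P(cell(A,v,u,u-e_κ))` when `B ⊇ B(A′)` (then `u - e_κ ∉ A′` on
`{(u,u-e_κ) ∉ B}`, so the cell's `𝟙{u′ ∉ C̃ ∪ A′}` is `Ψ^{(0)}`'s `𝟙{u′ ∉ C̃}`).
[cite: FitznerVanDerHofstad2017, (3.24)–(3.25) (arXiv:1506.07977v2 p. 25)] -/
theorem noblePsiBT_zero_eq_ite (p : unitInterval) {B : Set (Sym2 (Site d))} {A' : Set (Site d)}
    (hBa : bondsAt A' ⊆ B) (e : Site d) (A : Set (Site d)) (v u : Site d) :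
    noblePsiBT d p B A' e 0 A v u =
      if s(u, u - e) ∈ B then 0 else bondPercolation (zdGraph d) p (nobleCell B A' A v u (u - e)) := by
  rw [noblePsiBT_zero]
  by_cases hb : s(u, u - e) ∈ B
  · rw [if_pos hb]
    have h0 : {ω : BondConfig (Site d) | s(u, u - e) ∉ B ∧ offBonds B ω ∈ laceE A v u ∧
        u - e ∉ restrCluster u (u - e) v (offBonds B ω)} = ∅ :=
      Set.eq_empty_of_forall_notMem fun ω h => h.1 hb
    rw [h0, measure_empty]
  · rw [if_neg hb]
    have hu' : u - e ∉ A' := fun h => hb (hBa ⟨u - e, h, Sym2.mem_mk_right _ _⟩)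
    congr 1
    ext ω
    simp only [Set.mem_setOf_eq, mem_nobleCell_iff, Set.mem_union, not_or]
    tauto

/-- **Lemma 3.3 at `M = 0` without subtraction — the level-0 identity (3.18)–(3.25)**: for `p < p_c` and
outer data `(B, A′)` with `B(A′) ⊆ B ⊆ B({v} ∪ A′)` and NO DEGENERATE CELLS (`hBc`: no cell of the bond sum
uses a bond of `B` — automatic for `B = ∅`, for `(B(w),{w})` with `v ≠ w`, and for `({b}, ∅)` with `b ∋ v`,
`v ∉ A`; see the module docstring for why the printed "trivially zero" needs this reading),
`P^B(v ↔ x through A) + |R^B_0|(v,x;A) = Ξ^{B,(0)}(v,x;A) + Σ_u Σ_κ p Ψ^{B,(0),κ}(v,u;A) τ^κ(x-u+e_κ)`.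
[cite: FitznerVanDerHofstad2017, Lemma 3.3 (3.10) (arXiv:1506.07977v2 p. 23) at M = 0 via (3.16)–(3.25) (pp. 24–25) and "This proves Lemma 3.3 for M = 0" (p. 26)] -/
theorem probOff_connThrough_add_nobleRBT_zero {p : unitInterval}
    (hp : (p : ℝ) < criticalProb (zdGraph d) (0 : Site d)) {B : Set (Sym2 (Site d))} {A' : Set (Site d)}
    {v : Site d} (A : Set (Site d)) (x : Site d) (hBa : bondsAt A' ⊆ B) (hBb : B ⊆ bondsAt (insert v A'))
    (hBc : ∀ u u', s(u, u') ∈ B → nobleCell B A' A v u u' = ∅) :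
    probOff d p B (connThrough A v x) + nobleRBT d p B A' 0 A v x =
      nobleXiBT d p B A' 0 A v x + ∑' u, ∑ κ : Fin d × Bool, ENNReal.ofReal p *
        noblePsiBT d p B A' (Percolation.stepVec κ) 0 A v u *
          ENNReal.ofReal (tauOff d p (Percolation.stepVec κ) (x - u + Percolation.stepVec κ)) := by
  classical
  -- the cut term without its factor `J`
  set G : Site d × Site d → ℝ≥0∞ := fun q => if s(q.1, q.2) ∈ B then 0 else
    ∫⁻ ω, (occursOff B (laceE A v q.1)).indicator (fun ω => bondPercolation (zdGraph d) p
      (occursOff B (openConnIn (restrCluster q.1 q.2 v (offBonds B ω))ᶜ q.2 x))) ω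
      ∂(bondPercolation (zdGraph d) p) with hG
  have hGq : ∀ q : Site d × Site d, G q = if s(q.1, q.2) ∈ B then 0 else
      ∫⁻ ω, (occursOff B (laceE A v q.1)).indicator (fun ω => bondPercolation (zdGraph d) p
        (occursOff B (openConnIn (restrCluster q.1 q.2 v (offBonds B ω))ᶜ q.2 x))) ω
        ∂(bondPercolation (zdGraph d) p) := fun q => rfl
  have hcut : ∀ q : Site d × Site d,
      probOff d p B ({ω | s(q.1, q.2) ∈ ω} ∩ {ω | IsPivotalBond ω v x q.1 q.2} ∩ laceE A v q.1) =
        ENNReal.ofReal (bondJ d p (q.2 - q.1)) * G q := by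
    intro q
    rw [bondJ_sub, hGq]
    by_cases hadj : (zdGraph d).Adj q.1 q.2
    · rw [if_pos hadj, probOff_cut_eq hp hadj B A v x]
      by_cases hq : s(q.1, q.2) ∈ B
      · rw [if_pos hq, if_pos hq, mul_zero]
      · rw [if_neg hq, if_neg hq]
    · rw [if_neg hadj, ENNReal.ofReal_zero, zero_mul]
      have h0 : {ω : BondConfig (Site d) | s(q.1, q.2) ∈ ω} ∩ {ω | IsPivotalBond ω v x q.1 q.2} ∩
          laceE A v q.1 = ∅ := by
        refine Set.eq_empty_of_forall_notMem fun ω h => ?_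
        obtain ⟨⟨-, hadj', -, -⟩, -⟩ := h
        exact hadj hadj'
      rw [h0, probOff_def, occursOff_emptyset, measure_empty]
  -- the key pointwise step: cut term + remainder term = `Ψ^{(0)}`-cell times the full restricted two-point function
  have hstep : ∀ q : Site d × Site d, (zdGraph d).Adj q.1 q.2 →
      G q + ∫⁻ ω, (nobleCell B A' A v q.1 q.2).indicator
          (fun ω => nobleKerThrough d p q.1 (restrCluster q.1 q.2 v (offBonds B ω) ∪ A') q.2 x) ω ∂(bondPercolation (zdGraph d) p) =
        (if s(q.1, q.2) ∈ B then 0 else bondPercolation (zdGraph d) p (nobleCell B A' A v q.1 q.2)) *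
          probOff d p (bondsAt {q.1}) (openConn q.2 x) := by
    intro q hadj
    by_cases hq : s(q.1, q.2) ∈ B
    · rw [hGq, if_pos hq, if_pos hq, zero_mul, zero_add, hBc q.1 q.2 hq]
      simp only [Set.indicator_empty, lintegral_const, zero_mul]
    rw [hGq, if_neg hq, if_neg hq]
    have hq2 : q.2 ∉ A' := fun h => hq (hBa ⟨q.2, h, Sym2.mem_mk_right _ _⟩)
    rw [← lintegral_add_right _ (measurable_nobleIntegrand (nobleKerThrough_measurable p) B A' A v x q.1 q.2),
      mul_comm, ← lintegral_indicator_const (measurableSet_nobleCell B A' A v q.1 q.2)]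
    refine lintegral_congr fun ω => ?_
    by_cases hω : ω ∈ nobleCell B A' A v q.1 q.2
    · have hω' := (mem_nobleCell_iff B A' A v q.1 q.2 ω).1 hω
      rw [Set.indicator_of_mem hω, Set.indicator_of_mem hω,
        Set.indicator_of_mem (show ω ∈ occursOff B (laceE A v q.1) from hω'.1)]
      have hq2C : q.2 ∉ restrCluster q.1 q.2 v (offBonds B ω) := fun h => hω'.2 (Or.inl h)
      have hq1C : q.1 ∈ restrCluster q.1 q.2 v (offBonds B ω) :=
        mem_restrCluster_of_mem_laceE hω'.1 hq2C
      have hBS : B ⊆ bondsAt (restrCluster q.1 q.2 v (offBonds B ω) ∪ A') :=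
        hBb.trans (bondsAt_mono (Set.insert_subset (Or.inl (self_mem_restrCluster _ _ _ _))
          Set.subset_union_right))
      rw [occursOff_openConnIn_compl_eq hBa hBS hq2 x,
        probOff_bondsAt_openConn_eq_add p (T := restrCluster q.1 q.2 v (offBonds B ω) ∪ A') (Or.inl hq1C) q.2 x]
    · rw [Set.indicator_of_notMem hω, Set.indicator_of_notMem hω, add_zero]
      by_cases hl : ω ∈ occursOff B (laceE A v q.1)
      · rw [Set.indicator_of_mem hl]
        have hq2C : q.2 ∈ restrCluster q.1 q.2 v (offBonds B ω) := by
          by_contra h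
          exact hω ((mem_nobleCell_iff B A' A v q.1 q.2 ω).2 ⟨hl, fun h' => h'.elim h hq2⟩)
        rw [openConnIn_compl_eq_empty_of_mem hq2C x, occursOff_emptyset, measure_empty]
      · rw [Set.indicator_of_notMem hl]
  -- assemble: cutting-bond partition + the pointwise step, then the bond sum `Σ_{u'} J(u'-u) F(u') = Σ_κ p F(u-e_κ)`
  have hq : ∀ q : Site d × Site d,
      probOff d p B ({ω | s(q.1, q.2) ∈ ω} ∩ {ω | IsPivotalBond ω v x q.1 q.2} ∩ laceE A v q.1) +
        ENNReal.ofReal (bondJ d p (q.2 - q.1)) * ∫⁻ ω, (nobleCell B A' A v q.1 q.2).indicator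
          (fun ω => nobleKerThrough d p q.1 (restrCluster q.1 q.2 v (offBonds B ω) ∪ A') q.2 x) ω ∂(bondPercolation (zdGraph d) p) =
      ENNReal.ofReal (bondJ d p (q.2 - q.1)) *
        ((if s(q.1, q.2) ∈ B then 0 else bondPercolation (zdGraph d) p (nobleCell B A' A v q.1 q.2)) *
          probOff d p (bondsAt {q.1}) (openConn q.2 x)) := by
    intro q
    rw [hcut q, ← mul_add]
    by_cases hadj : (zdGraph d).Adj q.1 q.2
    · rw [hstep q hadj]
    · rw [bondJ_sub, if_neg hadj, ENNReal.ofReal_zero, zero_mul, zero_mul]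
  rw [probOff_connThrough_eq_laceE_add_tsum, ← nobleXiBT_zero, add_assoc]
  congr 1
  rw [nobleRBT_def, nobleIter_zero, nobleOp_apply, ← ENNReal.tsum_add]
  simp_rw [hq]
  rw [ENNReal.tsum_prod']
  refine tsum_congr fun u => ?_
  rw [tsum_bondJ_mul p u (fun u' => (if s(u, u') ∈ B then 0 else bondPercolation (zdGraph d) p (nobleCell B A' A v u u')) *
    probOff d p (bondsAt {u}) (openConn u' x))]
  refine Finset.sum_congr rfl fun κ _ => ?_
  rw [noblePsiBT_zero_eq_ite p hBa, probOff_bondsAt_openConn_shift p u, sub_sub_cancel,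
    probOff_bondsAt_openConn_eq_ofReal_tauOff,
    show x - (u - Percolation.stepVec κ) = x - u + Percolation.stepVec κ by abel, mul_assoc]

/-! ### E. The inner identity and its iterates; Lemma 3.3 -/

/-- **The inner level-0 identity**: for `v ≠ w` and `p < p_c`,
`P^{B(w)}(v ↔ x through A) + |R^{B(w)}_0|(v,x;A) = Ξ^{B(w),(0)}(v,x;A) + Σ_{(u,κ)} c_{(u,κ)}(x) Ψ^{B(w),(0),κ}(v,u;A)`
with the inner data `(B(w), {w})` — the expression `P^{b̲}(b̄ ↔ y through C̃ ∪ {b̲})` "has the same form".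
[cite: FitznerVanDerHofstad2017, (3.26) (arXiv:1506.07977v2 p. 26: "to rewrite the factor P^{b̲}_1(b̄ ↔ y through C̃^b_0(x) ∪ A′) appearing in R^B_0(x,y;A) as (3.26)")] -/
theorem nobleKerThrough_add_nobleOpW {p : unitInterval} (hp : (p : ℝ) < criticalProb (zdGraph d) (0 : Site d))
    {w v : Site d} (hvw : v ≠ w) (A : Set (Site d)) (x : Site d) :
    nobleKerThrough d p w A v x + nobleOpW d p (nobleKerThrough d p) w A v x =
      nobleKerXi d p w A v x + ∑' i, nobleTC d p i x * nobleKerPsi d p (Percolation.stepVec i.2) w A v i.1 := by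
  have h := probOff_connThrough_add_nobleRBT_zero hp A x (B := bondsAt {w}) (A' := {w}) (v := v) le_rfl
    (bondsAt_mono (Set.subset_insert _ _)) (fun u u' hb => nobleCell_bondsAt_eq_empty_of_ne hvw A hb)
  rw [nobleRBT_def, nobleIter_zero, nobleXiBT_zero] at h
  rw [nobleKerThrough_apply, nobleOpW_apply, nobleKerXi_apply, h,
    tsum_nobleTC_mul p (fun e u => nobleKerPsi d p e w A v u) x]
  congr 1
  refine tsum_congr fun u => Finset.sum_congr rfl fun κ _ => ?_
  congr 2
  -- `Ψ^{B(w),(0),κ}(v,u;A) = ψ^κ(w;A,v,u)` for `v ≠ w`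
  have hcell : bondPercolation (zdGraph d) p (nobleCell (bondsAt {w}) {w} A v u (u - Percolation.stepVec κ)) =
      nobleKerPsi d p (Percolation.stepVec κ) w A v u := by
    rw [measure_nobleCell_inner, sub_sub_cancel]
  rw [noblePsiBT_zero_eq_ite p le_rfl, ← hcell]
  split_ifs with hb
  · rw [nobleCell_bondsAt_eq_empty_of_ne hvw A hb, measure_empty]
  · rfl

/-- **The iterated inner identity** `K_n + K_{n+1} = X_n + Σ_i c_i P^{i}_n` for the nested kernels
`K_n = 𝒩^n[P^{B(w)}(through)]`, `X_n = 𝒩^n[ξ]`, `P^κ_n = 𝒩^n[ψ^κ]` (start `v ≠ w`).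
[cite: FitznerVanDerHofstad2017, (3.26)–(3.30) (arXiv:1506.07977v2 p. 26)] -/
theorem nobleIter_kerThrough_add_succ {p : unitInterval} (hp : (p : ℝ) < criticalProb (zdGraph d) (0 : Site d)) :
    ∀ (n : ℕ) {w v : Site d}, v ≠ w → ∀ (A : Set (Site d)) (x : Site d),
    nobleIter d p (nobleKerThrough d p) n w A v x + nobleIter d p (nobleKerThrough d p) (n + 1) w A v x =
      nobleIter d p (nobleKerXi d p) n w A v x +
        ∑' i, nobleTC d p i x * nobleIter d p (nobleKerPsi d p (Percolation.stepVec i.2)) n w A v i.1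
  | 0, w, v, hvw, A, x => by
    simpa only [nobleIter_zero, nobleIter_succ] using nobleKerThrough_add_nobleOpW hp hvw A x
  | n + 1, w, v, _, A, x => by
    have h := nobleOp_push p (bondsAt {w}) {w} (k₁ := nobleIter d p (nobleKerThrough d p) n)
      (k₂ := nobleIter d p (nobleKerThrough d p) (n + 1)) (k₃ := nobleIter d p (nobleKerXi d p) n)
      (k₄ := fun i => nobleIter d p (nobleKerPsi d p (Percolation.stepVec i.2)) n)
      (nobleIter_measurable p (nobleKerThrough_measurable p) n) (nobleIter_measurable p (nobleKerXi_measurable p) n)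
      (fun i => nobleIter_measurable p (nobleKerPsi_measurable p _) n)
      (fun u u' hadj A x => nobleIter_kerThrough_add_succ hp n hadj.ne.symm A x) A v x
    simpa only [nobleIter_succ, nobleOpW_apply] using h

/-- **The outer identity at level `n+1`** (no hypothesis on the outer data):
`|R^B_n| + |R^B_{n+1}| = Ξ^{B,(n+1)} + Σ_u Σ_κ p Ψ^{B,(n+1),κ}(v,u;A) τ^κ(x-u+e_κ)`.
[cite: FitznerVanDerHofstad2017, (3.30)–(3.33) (arXiv:1506.07977v2 pp. 26–27)] -/
theorem nobleRBT_add_succ {p : unitInterval} (hp : (p : ℝ) < criticalProb (zdGraph d) (0 : Site d))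
    (B : Set (Sym2 (Site d))) (A' : Set (Site d)) (n : ℕ) (A : Set (Site d)) (v x : Site d) :
    nobleRBT d p B A' n A v x + nobleRBT d p B A' (n + 1) A v x =
      nobleXiBT d p B A' (n + 1) A v x + ∑' u, ∑ κ : Fin d × Bool, ENNReal.ofReal p *
        noblePsiBT d p B A' (Percolation.stepVec κ) (n + 1) A v u *
          ENNReal.ofReal (tauOff d p (Percolation.stepVec κ) (x - u + Percolation.stepVec κ)) := by
  rw [nobleRBT_def, nobleRBT_def, nobleXiBT_succ,
    nobleOp_push p B A' (k₄ := fun i => nobleIter d p (nobleKerPsi d p (Percolation.stepVec i.2)) n)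
      (nobleIter_measurable p (nobleKerThrough_measurable p) n) (nobleIter_measurable p (nobleKerXi_measurable p) n)
      (fun i => nobleIter_measurable p (nobleKerPsi_measurable p _) n)
      (fun u u' hadj A x => nobleIter_kerThrough_add_succ hp n hadj.ne.symm A x) A v x,
    tsum_nobleTC_mul p (fun e u => nobleOp d p B A' (nobleIter d p (nobleKerPsi d p e) n) A v u) x]
  try congr 1

/-- Alternating telescoping in `[0,∞]` → `ℝ`. [folklore] -/
theorem toReal_eq_alternating_of_add {t : ℝ≥0∞} {a r : ℕ → ℝ≥0∞} (ht : t ≠ ∞) (hr : ∀ n, r n ≠ ∞)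
    (h0 : t + r 0 = a 0) (hsucc : ∀ n, r n + r (n + 1) = a (n + 1)) (M : ℕ) :
    t.toReal = ∑ N ∈ Finset.range (M + 1), (-1 : ℝ) ^ N * (a N).toReal + (-1 : ℝ) ^ (M + 1) * (r M).toReal := by
  induction M with
  | zero =>
    have h := congrArg ENNReal.toReal h0
    rw [ENNReal.toReal_add ht (hr 0)] at h
    simp only [zero_add, Finset.range_one, Finset.sum_singleton, pow_zero, one_mul, pow_one]
    linarith
  | succ M ih =>
    have ha : (a (M + 1)).toReal = (r M).toReal + (r (M + 1)).toReal := by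
      rw [← hsucc M, ENNReal.toReal_add (hr M) (hr (M + 1))]
    rw [Finset.sum_range_succ, ha, ih, pow_succ, pow_succ]
    ring

/-- The transfer sums of Lemma 3.3 are finite for `p < p_c` (`d ≥ 2`). [cite: FitznerVanDerHofstad2017, (3.34)–(3.35) (arXiv:1506.07977v2 p. 27)] -/
theorem tsum_noblePsiBT_tauOff_ne_top (hd : 2 ≤ d) {p : unitInterval} (hp : p < criticalProbI d)
    (B : Set (Sym2 (Site d))) (A' : Set (Site d)) (N : ℕ) (A : Set (Site d)) (v x : Site d) :
    (∑' u, ∑ κ : Fin d × Bool, ENNReal.ofReal p * noblePsiBT d p B A' (Percolation.stepVec κ) N A v u *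
        ENNReal.ofReal (tauOff d p (Percolation.stepVec κ) (x - u + Percolation.stepVec κ))) ≠ ∞ := by
  have hpR := coe_lt_criticalProb_of_lt hp
  refine ne_top_of_le_ne_top (ENNReal.mul_ne_top (ENNReal.natCast_ne_top (Fintype.card (Fin d × Bool)))
    (tsum_nobleMaj_sub_ne_top hd hpR N v)) ?_
  rw [← ENNReal.tsum_mul_left]
  refine ENNReal.tsum_le_tsum fun y => ?_
  calc ∑ κ : Fin d × Bool, ENNReal.ofReal p * noblePsiBT d p B A' (Percolation.stepVec κ) N A v y *
        ENNReal.ofReal (tauOff d p (Percolation.stepVec κ) (x - y + Percolation.stepVec κ))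
      ≤ ∑ _κ : Fin d × Bool, nobleMaj d p N (y - v) := Finset.sum_le_sum fun κ _ => by
        calc ENNReal.ofReal p * noblePsiBT d p B A' (Percolation.stepVec κ) N A v y *
              ENNReal.ofReal (tauOff d p (Percolation.stepVec κ) (x - y + Percolation.stepVec κ))
            ≤ 1 * nobleMaj d p N (y - v) * 1 :=
              mul_le_mul' (mul_le_mul' (ofReal_coe_le_one p) (noblePsiBT_le_nobleMaj le_rfl B A' _ N A v y))
                (ENNReal.ofReal_le_one.2 (tauOff_le_one p _ _))
          _ = nobleMaj d p N (y - v) := by rw [one_mul, mul_one]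
    _ = (Fintype.card (Fin d × Bool) : ℝ≥0∞) * nobleMaj d p N (y - v) := by
        rw [Finset.sum_const, Finset.card_univ, nsmul_eq_mul]

/-- **Lemma 3.3 (NoBLE expansion identity with general outer data), (3.10)**: for `d ≥ 2`, `p < p_c`, every
`M ≥ 0`, and outer data `(B, A′)` with `B(A′) ⊆ B ⊆ B({v} ∪ A′)` and no degenerate cells,
`P^B(v ↔ x through A) = Σ_{N=0}^{M} (-1)^N Ξ^{B,(N)}(v,x;A)`
`  + Σ_u Σ_κ p [Σ_{N=0}^{M} (-1)^N Ψ^{B,(N),κ}(v,u;A)] τ^κ(x-u+e_κ) + R^B_M(v,x;A)`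
(the `N`-sum written term by term: `Σ_N (-1)^N (Ξ^{B,(N)} + Σ_u Σ_κ p Ψ^{B,(N),κ} τ^κ)`), with
`R^B_M = (-1)^{M+1}|R^B_M|` (3.33).
[cite: FitznerVanDerHofstad2017, Lemma 3.3 (3.10)–(3.11) (arXiv:1506.07977v2 p. 23); proof (3.15)–(3.33) (pp. 24–27)] -/
theorem probOff_connThrough_toReal_eq_alternating (hd : 2 ≤ d) {p : unitInterval} (hp : p < criticalProbI d)
    {B : Set (Sym2 (Site d))} {A' : Set (Site d)} {v : Site d} (A : Set (Site d)) (x : Site d)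
    (hBa : bondsAt A' ⊆ B) (hBb : B ⊆ bondsAt (insert v A'))
    (hBc : ∀ u u', s(u, u') ∈ B → nobleCell B A' A v u u' = ∅) (M : ℕ) :
    (probOff d p B (connThrough A v x)).toReal =
      ∑ N ∈ Finset.range (M + 1), (-1 : ℝ) ^ N * (nobleXiBT d p B A' N A v x +
        ∑' u, ∑ κ : Fin d × Bool, ENNReal.ofReal p * noblePsiBT d p B A' (Percolation.stepVec κ) N A v u *
          ENNReal.ofReal (tauOff d p (Percolation.stepVec κ) (x - u + Percolation.stepVec κ))).toReal
      + nobleRB d p B A' M A v x := by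
  have hpR := coe_lt_criticalProb_of_lt hp
  rw [nobleRB_def]
  exact toReal_eq_alternating_of_add (a := fun N => nobleXiBT d p B A' N A v x +
      ∑' u, ∑ κ : Fin d × Bool, ENNReal.ofReal p * noblePsiBT d p B A' (Percolation.stepVec κ) N A v u *
        ENNReal.ofReal (tauOff d p (Percolation.stepVec κ) (x - u + Percolation.stepVec κ)))
    (r := fun N => nobleRBT d p B A' N A v x)
    (ne_top_of_le_ne_top ENNReal.one_ne_top (probOff_le_one p B _)) (fun n => nobleRBT_ne_top hd B A' n A v x hp)
    (probOff_connThrough_add_nobleRBT_zero hpR A x hBa hBb hBc) (fun n => nobleRBT_add_succ hpR B A' n A v x) M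

/-! ### F. The coefficients of §3.3 at the origin: `Ξ^{∅,(0)}(0,0;{0}) = 1`, `p Ψ^{∅,(0),κ}(0,0;{0}) = μ_p` -/

/-- `Ξ^{∅,(N)}(0,x;{0}) = Ξ^{(N)}(x) + δ_{N,0}δ_{x,0}` in `[0,∞]` ((3.41): `Ξ^{(0)}` carries the factor `1 - δ_{0,x}`,
and `E'(0,0;{0})` is the sure event). [cite: FitznerVanDerHofstad2017, (3.23) (arXiv:1506.07977v2 p. 25), (3.40)–(3.41) (p. 28)] -/
theorem nobleXiBT_empty_eq (p : unitInterval) (N : ℕ) (x : Site d) :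
    nobleXiBT d p ∅ ∅ N {0} 0 x = nobleXiT d p N x + if N = 0 ∧ x = 0 then 1 else 0 := by
  by_cases h : N = 0 ∧ x = 0
  · obtain ⟨rfl, rfl⟩ := h
    rw [if_pos ⟨rfl, rfl⟩, nobleXiT_zero_zero, zero_add, nobleXiBT_zero, probOff_empty,
      laceE_self_eq_univ (Set.mem_singleton (0 : Site d)), measure_univ]
  · rw [if_neg h, add_zero, nobleXiT_of_ne (not_and_or.mp h)]

/-- `Ψ^{∅,(0),κ}(0,0;{0}) = P_p(-e_κ ∉ C̃^{(0,-e_κ)}(0))` (the cell event at the origin: `E'(0,0;{0})` is sure).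
[cite: FitznerVanDerHofstad2017, (3.24) (arXiv:1506.07977v2 p. 25), (3.40) (p. 28)] -/
theorem noblePsiBT_empty_origin (p : unitInterval) (e : Site d) :
    noblePsiBT d p ∅ ∅ e 0 {0} 0 0 = bondPercolation (zdGraph d) p {ω | -e ∉ restrCluster 0 (-e) 0 ω} := by
  rw [noblePsiBT_zero_eq_ite p (by rw [bondsAt_empty]), if_neg (Set.notMem_empty _)]
  congr 1
  ext ω
  rw [mem_nobleCell_iff, offBonds_empty, laceE_self_eq_univ (Set.mem_singleton (0 : Site d)), Set.union_empty,
    zero_sub, Set.mem_setOf_eq]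
  exact ⟨fun h => h.2, fun h => ⟨Set.mem_univ _, h⟩⟩

/-- `Ψ^{∅,(0),κ}(0,0;{0})` does not depend on the direction `κ` (a signed permutation of the axes fixing `0`
maps `e_{κ'}` to `e_κ`). [cite: FitznerVanDerHofstad2017, §3.5 (symmetry; arXiv:1506.07977v2 p. 33)] -/
theorem noblePsiBT_empty_origin_eq (p : unitInterval) (κ κ' : Fin d × Bool) :
    noblePsiBT d p ∅ ∅ (Percolation.stepVec κ) 0 {0} 0 0 = noblePsiBT d p ∅ ∅ (Percolation.stepVec κ') 0 {0} 0 0 := by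
  obtain ⟨π, ε, h⟩ := exists_signedPerm_stepVec κ' κ
  have hφ := zdSignedPermIso_sub π ε
  have h0 : zdSignedPermIso π ε 0 = 0 := iso_map_zero _ hφ
  have key := noblePsiBT_relabel (zdSignedPermIso π ε) hφ p ∅ ∅ (Percolation.stepVec κ') 0 {0} 0 0
  rw [relabel_empty, Set.image_empty, Set.image_singleton, h0, zdSignedPermIso_apply, h] at key
  exact key

/-- **`p · P_p(e₁ ∉ C̃^{(0,e₁)}(0)) = μ_p`**: since `{0 ↮ e₁} = {(0,e₁) vacant} ∩ {e₁ ∉ C̃^{(0,e₁)}(0)}` and the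
two events are independent, `P(e₁ ∉ C̃^{(0,e₁)}(0)) = P(e₁ ∉ C(0) | (0,e₁) vacant)`.
[cite: FitznerVanDerHofstad2017, (3.42) ("μ_p = p P(e ∉ C̃^{(0,e)}(0))", arXiv:1506.07977v2 p. 28); §2.4 (definition of μ_p)] -/
theorem ofReal_mul_measure_notMem_restrCluster (hd : 1 ≤ d) (p : unitInterval) (hp : (p : ℝ) < 1) :
    ENNReal.ofReal p * bondPercolation (zdGraph d) p {ω | unitSite1 d ∉ restrCluster 0 (unitSite1 d) 0 ω} =
      ENNReal.ofReal (nobleMu d p) := by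
  classical
  have he0 : unitSite1 d ≠ 0 := unitSite1_ne_zero hd
  have hedge : s((0 : Site d), unitSite1 d) ∈ (zdGraph d).edgeSet :=
    (SimpleGraph.mem_edgeSet _).2 (zdGraph_adj_zero_unitSite1 hd)
  set μ := bondPercolation (zdGraph d) p with hμ
  set W : Set (BondConfig (Site d)) := {ω | unitSite1 d ∉ restrCluster 0 (unitSite1 d) 0 ω} with hW
  have hWeq : W = (fun ω => ω \ {s((0 : Site d), unitSite1 d)}) ⁻¹' (openConn (0 : Site d) (unitSite1 d))ᶜ := by
    ext ω; exact Iff.rfl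
  have hBm : MeasurableSet (openConn (0 : Site d) (unitSite1 d))ᶜ := (measurableSet_openConn_holds _ _).compl
  have h1 : μ (W ∩ {ω | s((0 : Site d), unitSite1 d) ∈ ω}) + μ (W \ {ω | s((0 : Site d), unitSite1 d) ∈ ω}) = μ W :=
    measure_inter_add_sdiff W (measurableSet_mem _)
  have h2 : μ (W ∩ {ω | s((0 : Site d), unitSite1 d) ∈ ω}) = ENNReal.ofReal p * μ W := by
    rw [Set.inter_comm, hWeq, hμ, measure_mem_inter_preimage_sdiff p _ hBm, measure_setOf_mem_edge p hedge]
  have h3 : W \ {ω | s((0 : Site d), unitSite1 d) ∈ ω} = (openConn (0 : Site d) (unitSite1 d))ᶜ := by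
    ext ω
    simp only [Set.mem_sdiff, hW, Set.mem_setOf_eq, Set.mem_compl_iff, mem_restrCluster_iff, openConn]
    constructor
    · rintro ⟨hW', hb⟩
      rwa [Set.sdiff_singleton_eq_self hb] at hW'
    · intro h
      refine ⟨fun hr => h (hr.mono (openGraph_mono Set.sdiff_subset)), fun hb => h ?_⟩
      exact ((openGraph_adj ω 0 (unitSite1 d)).2 ⟨hb, he0.symm⟩).reachable
  have h4 : μ W = ENNReal.ofReal p * μ W + μ (openConn (0 : Site d) (unitSite1 d))ᶜ := by
    calc μ W = μ (W ∩ {ω | s((0 : Site d), unitSite1 d) ∈ ω}) + μ (W \ {ω | s((0 : Site d), unitSite1 d) ∈ ω}) :=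
          h1.symm
      _ = _ := by rw [h2, h3]
  have hWfin : μ W ≠ ∞ := measure_ne_top _ _
  have hreal : (μ W).toReal = (p : ℝ) * (μ W).toReal + (1 - tau d p 0 (unitSite1 d)) := by
    have h := congrArg ENNReal.toReal h4
    rw [ENNReal.toReal_add (ENNReal.mul_ne_top ENNReal.ofReal_ne_top hWfin) (measure_ne_top _ _),
      ENNReal.toReal_mul, ENNReal.toReal_ofReal p.2.1] at h
    have hc : (μ (openConn (0 : Site d) (unitSite1 d))ᶜ).toReal = 1 - tau d p 0 (unitSite1 d) := by
      rw [← measureReal_def, probReal_compl_eq_one_sub (measurableSet_openConn_holds _ _), tau_def]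
    rw [hc] at h
    exact h
  have hp1 : (1 - (p : ℝ)) ≠ 0 := by linarith
  have hw : (μ W).toReal = (1 - tau d p 0 (unitSite1 d)) / (1 - p) := by
    rw [eq_div_iff hp1]; linarith
  rw [← ENNReal.ofReal_toReal hWfin, ← ENNReal.ofReal_mul p.2.1, hw, nobleMu_eq hd p hp, mul_div_assoc]

/-- **`p Ψ^{∅,(0),κ}(0,0;{0}) = μ_p` for every direction `κ`** (`d ≥ 1`, `p < 1`): the normalisation of (3.42)–(3.43)
at `(N, x) = (0, 0)`. [cite: FitznerVanDerHofstad2017, (3.40), (3.42) (arXiv:1506.07977v2 p. 28)] -/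
theorem ofReal_mul_noblePsiBT_empty_origin (hd : 1 ≤ d) (p : unitInterval) (hp : (p : ℝ) < 1) (κ : Fin d × Bool) :
    ENNReal.ofReal p * noblePsiBT d p ∅ ∅ (Percolation.stepVec κ) 0 {0} 0 0 = ENNReal.ofReal (nobleMu d p) := by
  have he : -Percolation.stepVec ((⟨0, hd⟩ : Fin d), false) = unitSite1 d := by
    rw [stepVec_eq_single, unitSite1_eq_single hd, ← Pi.single_neg]
    simp
  rw [noblePsiBT_empty_origin_eq p κ (⟨0, hd⟩, false), noblePsiBT_empty_origin, he]
  exact ofReal_mul_measure_notMem_restrCluster hd p hp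

/-! ### G. Proposition 2.1, first relation (2.14) = (3.48) at finite `M` -/

/-- `p Ψ^{∅,(N),κ}(0,u;{0}) = μ_p Ψ^{(N),κ}(u) + δ_{N,0}δ_{u,0} μ_p` in `[0,∞]` (the normalisation (3.43) and the
origin term (3.40), (3.42)). [cite: FitznerVanDerHofstad2017, (3.40), (3.42)–(3.43) (arXiv:1506.07977v2 p. 28)] -/
theorem ofReal_mul_noblePsiBT_empty_eq (hd : 2 ≤ d) {p : unitInterval} (hp : p < criticalProbI d)
    (κ : Fin d × Bool) (N : ℕ) (u : Site d) :
    ENNReal.ofReal p * noblePsiBT d p ∅ ∅ (Percolation.stepVec κ) N {0} 0 u =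
      ENNReal.ofReal (nobleMu d p * noblePsiN d p (Percolation.stepVec κ) N u) +
        if N = 0 ∧ u = 0 then ENNReal.ofReal (nobleMu d p) else 0 := by
  have hp1 : (p : ℝ) < 1 := lt_of_lt_of_le (show (p : ℝ) < criticalProbI d from hp) (criticalProbI d).2.2
  by_cases h : N = 0 ∧ u = 0
  · obtain ⟨rfl, rfl⟩ := h
    rw [if_pos ⟨rfl, rfl⟩, ofReal_mul_noblePsiBT_empty_origin (by omega) p hp1, noblePsiN_def, noblePsiT_zero_zero,
      ENNReal.toReal_zero, mul_zero, mul_zero, ENNReal.ofReal_zero, zero_add]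
  · rw [if_neg h, add_zero, ← noblePsiT_of_ne (not_and_or.mp h)]
    have hfin : noblePsiT d p (Percolation.stepVec κ) N u ≠ ∞ :=
      ne_top_of_le_ne_top (nobleXiT_ne_top hd hp N u) (noblePsiT_le_nobleXiT p _ N u)
    rcases (show (0 : ℝ) ≤ p from p.2.1).eq_or_lt with hp0 | hp0
    · have hμ0 : nobleMu d p = 0 := by rw [nobleMu, ← hp0, zero_mul]
      rw [← hp0, hμ0, zero_mul, ENNReal.ofReal_zero, zero_mul]
    · have hμ : nobleMu d p ≠ 0 := (nobleMu_pos (by omega) hp0 hp1).ne'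
      rw [noblePsiN_def, ← mul_assoc, mul_div_cancel₀ _ hμ, ENNReal.ofReal_mul p.2.1, ENNReal.ofReal_toReal hfin]

/-- The real `y`-sum of (2.14) at level `N`: `Σ_y Σ_κ Ψ^{(N),κ}(y) τ^κ(x - y + e_κ)` converges (`p < p_c`). [cite: FitznerVanDerHofstad2017, (3.34)–(3.35), (3.43) (arXiv:1506.07977v2 pp. 27–28)] -/
theorem summable_noblePsiN_mul_tauOff (hd : 2 ≤ d) {p : unitInterval} (hp : p < criticalProbI d) (e e' : Site d)
    (N : ℕ) (x : Site d) : Summable (fun y => noblePsiN d p e N y * tauOff d p e' (x - y + e')) := by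
  have h := (summable_weighted_noblePsiT_toReal hd hp e N (fun y => tauOff d p e' (x - y + e'))
    (fun y => abs_le.2 ⟨by linarith [tauOff_nonneg p e' (x - y + e')], tauOff_le_one p _ _⟩)).mul_left
    ((p : ℝ) / nobleMu d p)
  refine h.congr fun y => ?_
  simp only [noblePsiN_def]
  ring

/-- **The level-`N` transfer term of (3.40) in closed form**:
`Σ_u Σ_κ p Ψ^{∅,(N),κ}(0,u;{0}) τ^κ(x-u+e_κ) = μ_p Σ_y Σ_κ Ψ^{(N),κ}(y) τ^κ(x-y+e_κ) + δ_{N,0} μ_p Σ_κ τ^κ(x+e_κ)`.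
[cite: FitznerVanDerHofstad2017, (3.39)–(3.45) (arXiv:1506.07977v2 p. 28)] -/
theorem tsum_transfer_empty_eq (hd : 2 ≤ d) {p : unitInterval} (hp : p < criticalProbI d) (N : ℕ) (x : Site d) :
    (∑' u, ∑ κ : Fin d × Bool, ENNReal.ofReal p * noblePsiBT d p ∅ ∅ (Percolation.stepVec κ) N {0} 0 u *
        ENNReal.ofReal (tauOff d p (Percolation.stepVec κ) (x - u + Percolation.stepVec κ))) =
      ENNReal.ofReal (nobleMu d p * ∑' y, ∑ κ : Fin d × Bool, noblePsiN d p (Percolation.stepVec κ) N y *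
          tauOff d p (Percolation.stepVec κ) (x - y + Percolation.stepVec κ)) +
        if N = 0 then ENNReal.ofReal (nobleMu d p * ∑ κ : Fin d × Bool,
          tauOff d p (Percolation.stepVec κ) (x + Percolation.stepVec κ)) else 0 := by
  have hμ := nobleMu_nonneg d p
  have hterm : ∀ (u : Site d) (κ : Fin d × Bool),
      ENNReal.ofReal p * noblePsiBT d p ∅ ∅ (Percolation.stepVec κ) N {0} 0 u *
          ENNReal.ofReal (tauOff d p (Percolation.stepVec κ) (x - u + Percolation.stepVec κ)) =
        ENNReal.ofReal (nobleMu d p * (noblePsiN d p (Percolation.stepVec κ) N u *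
            tauOff d p (Percolation.stepVec κ) (x - u + Percolation.stepVec κ))) +
          (if N = 0 ∧ u = 0 then ENNReal.ofReal (nobleMu d p) else 0) *
            ENNReal.ofReal (tauOff d p (Percolation.stepVec κ) (x - u + Percolation.stepVec κ)) := by
    intro u κ
    rw [ofReal_mul_noblePsiBT_empty_eq hd hp κ N u, add_mul,
      ← ENNReal.ofReal_mul (mul_nonneg hμ (noblePsiN_nonneg' p _ N u)), mul_assoc]
  simp_rw [hterm, Finset.sum_add_distrib]
  rw [ENNReal.tsum_add]
  congr 1
  · -- the regular part: everything is a non-negative real series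
    have hs : ∀ κ : Fin d × Bool, Summable fun y => nobleMu d p * (noblePsiN d p (Percolation.stepVec κ) N y *
        tauOff d p (Percolation.stepVec κ) (x - y + Percolation.stepVec κ)) :=
      fun κ => (summable_noblePsiN_mul_tauOff hd hp _ _ N x).mul_left _
    have hnn : ∀ (y : Site d) (κ : Fin d × Bool), 0 ≤ nobleMu d p * (noblePsiN d p (Percolation.stepVec κ) N y *
        tauOff d p (Percolation.stepVec κ) (x - y + Percolation.stepVec κ)) :=
      fun y κ => mul_nonneg hμ (mul_nonneg (noblePsiN_nonneg' p _ N y) (tauOff_nonneg p _ _))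
    calc ∑' u, ∑ κ : Fin d × Bool, ENNReal.ofReal (nobleMu d p * (noblePsiN d p (Percolation.stepVec κ) N u *
            tauOff d p (Percolation.stepVec κ) (x - u + Percolation.stepVec κ)))
        = ∑' u, ENNReal.ofReal (∑ κ : Fin d × Bool, nobleMu d p * (noblePsiN d p (Percolation.stepVec κ) N u *
            tauOff d p (Percolation.stepVec κ) (x - u + Percolation.stepVec κ))) :=
          tsum_congr fun u => (ENNReal.ofReal_sum_of_nonneg fun κ _ => hnn u κ).symm
      _ = ENNReal.ofReal (∑' u, ∑ κ : Fin d × Bool, nobleMu d p * (noblePsiN d p (Percolation.stepVec κ) N u *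
            tauOff d p (Percolation.stepVec κ) (x - u + Percolation.stepVec κ))) :=
          (ENNReal.ofReal_tsum_of_nonneg (fun u => Finset.sum_nonneg fun κ _ => hnn u κ)
            (summable_sum fun κ _ => hs κ)).symm
      _ = _ := by
          congr 1
          rw [← tsum_mul_left]
          exact tsum_congr fun u => (Finset.mul_sum _ _ _).symm
  · -- the origin part
    by_cases hN : N = 0
    · subst hN
      rw [if_pos rfl, tsum_eq_single (0 : Site d) (fun u hu => by simp [hu])]
      simp only [true_and, if_true, sub_zero]
      rw [← Finset.mul_sum, ENNReal.ofReal_mul hμ, ENNReal.ofReal_sum_of_nonneg fun κ _ => tauOff_nonneg p _ _]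
    · simp [hN]

/-- **The level-`N` term of (3.40) = (3.10) for the origin data, in real form**:
`(Ξ^{∅,(N)}(0,x;{0}) + Σ_uΣ_κ pΨ^{∅,(N),κ}(0,u;{0})τ^κ(x-u+e_κ)) = Ξ^{(N)}(x) + μ_pΣ_yΣ_κΨ^{(N),κ}(y)τ^κ(x-y+e_κ)`
`  + δ_{N,0}(δ_{0,x} + μ_p Σ_κ τ^κ(x+e_κ))`.
[cite: FitznerVanDerHofstad2017, (3.39)–(3.45) (arXiv:1506.07977v2 p. 28)] -/
theorem toReal_level_empty_eq (hd : 2 ≤ d) {p : unitInterval} (hp : p < criticalProbI d) (N : ℕ) (x : Site d) :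
    (nobleXiBT d p ∅ ∅ N {0} 0 x +
        ∑' u, ∑ κ : Fin d × Bool, ENNReal.ofReal p * noblePsiBT d p ∅ ∅ (Percolation.stepVec κ) N {0} 0 u *
          ENNReal.ofReal (tauOff d p (Percolation.stepVec κ) (x - u + Percolation.stepVec κ))).toReal =
      nobleXiN d p N x + nobleMu d p * (∑' y, ∑ κ : Fin d × Bool, noblePsiN d p (Percolation.stepVec κ) N y *
          tauOff d p (Percolation.stepVec κ) (x - y + Percolation.stepVec κ)) +
        if N = 0 then (if x = 0 then 1 else 0) + nobleMu d p * ∑ κ : Fin d × Bool,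
          tauOff d p (Percolation.stepVec κ) (x + Percolation.stepVec κ) else 0 := by
  have hμ := nobleMu_nonneg d p
  have hS : 0 ≤ nobleMu d p * ∑' y, ∑ κ : Fin d × Bool, noblePsiN d p (Percolation.stepVec κ) N y *
      tauOff d p (Percolation.stepVec κ) (x - y + Percolation.stepVec κ) :=
    mul_nonneg hμ (tsum_nonneg fun y => Finset.sum_nonneg fun κ _ =>
      mul_nonneg (noblePsiN_nonneg' p _ N y) (tauOff_nonneg p _ _))
  have hT : 0 ≤ nobleMu d p * ∑ κ : Fin d × Bool, tauOff d p (Percolation.stepVec κ) (x + Percolation.stepVec κ) :=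
    mul_nonneg hμ (Finset.sum_nonneg fun κ _ => tauOff_nonneg p _ _)
  rw [ENNReal.toReal_add (nobleXiBT_ne_top hd ∅ ∅ N {0} 0 x hp) (tsum_noblePsiBT_tauOff_ne_top hd hp ∅ ∅ N {0} 0 x),
    nobleXiBT_empty_eq, tsum_transfer_empty_eq hd hp N x,
    ENNReal.toReal_add (nobleXiT_ne_top hd hp N x) (by split_ifs <;> simp),
    ENNReal.toReal_add ENNReal.ofReal_ne_top (by split_ifs <;> simp), ← nobleXiN_def, ENNReal.toReal_ofReal hS]
  by_cases hN : N = 0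
  · subst hN
    by_cases hx : x = 0
    · subst hx
      have hT' : 0 ≤ nobleMu d p * ∑ κ : Fin d × Bool,
          tauOff d p (Percolation.stepVec κ) (Percolation.stepVec κ) := by simpa using hT
      simp [ENNReal.toReal_ofReal hT']
      ring
    · simp [hx, ENNReal.toReal_ofReal hT]
      ring
  · simp [hN]

/-- Interchange of the finite alternating `N`-sum with the `y`-sum:
`Σ_{N≤M} (-1)^N Σ_y Σ_κ Ψ^{(N),κ}(y) τ^κ(…) = Σ_y Σ_κ Ψ^κ_M(y) τ^κ(…)`. [cite: FitznerVanDerHofstad2017, (3.44)–(3.45) (arXiv:1506.07977v2 p. 28)] -/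
theorem sum_alternating_transfer_eq (hd : 2 ≤ d) {p : unitInterval} (hp : p < criticalProbI d) (M : ℕ) (x : Site d) :
    ∑ N ∈ Finset.range (M + 1), (-1 : ℝ) ^ N * ∑' y, ∑ κ : Fin d × Bool, noblePsiN d p (Percolation.stepVec κ) N y *
        tauOff d p (Percolation.stepVec κ) (x - y + Percolation.stepVec κ) =
      ∑' y, ∑ κ : Fin d × Bool, noblePsiM d p (Percolation.stepVec κ) M y *
        tauOff d p (Percolation.stepVec κ) (x - y + Percolation.stepVec κ) := by
  have hs : ∀ N ∈ Finset.range (M + 1), Summable fun y => (-1 : ℝ) ^ N * ∑ κ : Fin d × Bool,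
      noblePsiN d p (Percolation.stepVec κ) N y * tauOff d p (Percolation.stepVec κ) (x - y + Percolation.stepVec κ) :=
    fun N _ => (summable_sum fun κ _ => summable_noblePsiN_mul_tauOff hd hp _ _ N x).mul_left _
  simp_rw [← tsum_mul_left]
  rw [← Summable.tsum_finsetSum hs]
  refine tsum_congr fun y => ?_
  simp only [noblePsiM, Finset.mul_sum, Finset.sum_mul, mul_assoc]
  exact Finset.sum_comm

/-- **Proposition 2.1, first NoBLE relation (2.14) at finite `M`** (= (3.48) with (3.40)–(3.44)): for `d ≥ 2`,
`p < p_c`, every `M ≥ 0` and `x ∈ ℤ^d`,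
`τ_p(x) = δ_{0,x} + Ξ_M(x) + μ_p [Σ_ι τ^ι(x + e_ι) + Σ_y Σ_ι Ψ^ι_M(y) τ^ι(x - y + e_ι)] + R_M(x)`
(`Ξ_M`, `Ψ^ι_M` the alternating partial sums (3.44) without `R_M`, `R_M = (-1)^{M+1}|R^∅_M|(0,x;{0})`).
[cite: FitznerVanDerHofstad2017, Prop. 2.1 (2.14) (arXiv:1506.07977v2 p. 10 = EJP 22 (2017) no. 43 p. 10); (3.39)–(3.45) (arXiv v2 p. 28)] -/
theorem noble_eq_one_finite (hd : 2 ≤ d) {p : unitInterval} (hp : p < criticalProbI d) (M : ℕ) (x : Site d) :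
    tau d p 0 x = (if x = 0 then 1 else 0) + nobleXiM d p M x +
      nobleMu d p * (∑ ι : Fin d × Bool, tauOff d p (Percolation.stepVec ι) (x + Percolation.stepVec ι) +
        ∑' y, ∑ ι : Fin d × Bool, noblePsiM d p (Percolation.stepVec ι) M y *
          tauOff d p (Percolation.stepVec ι) (x - y + Percolation.stepVec ι)) + nobleR d p M x := by
  have h := probOff_connThrough_toReal_eq_alternating hd hp {0} x (B := ∅) (A' := ∅) (v := 0)
    (by rw [bondsAt_empty]) (Set.empty_subset _) (fun u u' h => absurd h (Set.notMem_empty _)) M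
  rw [probOff_empty, connThrough_singleton_start, ← measureReal_def, ← tau_def] at h
  rw [h, nobleR]
  simp_rw [toReal_level_empty_eq hd hp, mul_add, Finset.sum_add_distrib]
  have h1 : ∑ N ∈ Finset.range (M + 1), (-1 : ℝ) ^ N * (nobleMu d p * ∑' y, ∑ κ : Fin d × Bool,
      noblePsiN d p (Percolation.stepVec κ) N y * tauOff d p (Percolation.stepVec κ) (x - y + Percolation.stepVec κ)) =
      nobleMu d p * ∑' y, ∑ κ : Fin d × Bool, noblePsiM d p (Percolation.stepVec κ) M y *
        tauOff d p (Percolation.stepVec κ) (x - y + Percolation.stepVec κ) := by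
    rw [← sum_alternating_transfer_eq hd hp M x, Finset.mul_sum]
    exact Finset.sum_congr rfl fun N _ => by ring
  have h2 : ∑ N ∈ Finset.range (M + 1), (-1 : ℝ) ^ N * (if N = 0 then (if x = 0 then 1 else 0) + nobleMu d p *
      ∑ κ : Fin d × Bool, tauOff d p (Percolation.stepVec κ) (x + Percolation.stepVec κ) else 0) =
      (if x = 0 then 1 else 0) + nobleMu d p * ∑ κ : Fin d × Bool,
        tauOff d p (Percolation.stepVec κ) (x + Percolation.stepVec κ) := by
    simp [Finset.sum_ite_eq', Finset.mem_range]
  rw [h1, h2, ← nobleXiM]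
  ring

/-! ### H. Proposition 2.1, second relation (2.15) = (3.49) at finite `M ≥ 1` -/

/-- `ω ∈ {x ⟷ x in S}` iff `x ∈ S`. [folklore] -/
theorem mem_openConnIn_self_iff {S : Set (Site d)} {x : Site d} {ω : BondConfig (Site d)} :
    ω ∈ openConnIn S x x ↔ x ∈ S :=
  ⟨fun h => (pathIn_of_mem_openConnIn h).left_mem, fun h => mem_openConnIn_of_pathIn (PathIn.refl h)⟩

/-- On `{0 ↔ x in ω ∖ b}`, `b = (0,e)`, removing `b` does not change `{0 ↔ x through {e}}`. [folklore] -/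
theorem connThrough_singleton_sdiff_iff {e : Site d} (x : Site d) {ω : BondConfig (Site d)}
    (h : ω \ {s(0, e)} ∈ openConn 0 x) : ω \ {s(0, e)} ∈ connThrough {e} 0 x ↔ ω ∈ connThrough {e} 0 x := by
  have hsw : s((0 : Site d), e) = s(e, 0) := Sym2.eq_swap
  rw [hsw] at h ⊢
  rw [mem_connThrough_iff, mem_connThrough_iff,
    openConnIn_sdiff_iff_of_notMem ω (B := ({e} : Set (Site d))ᶜ) (a := e) (b := 0) (by simp)]
  exact ⟨fun h' => ⟨SimpleGraph.Reachable.mono (openGraph_mono Set.sdiff_subset) h, h'.2⟩, fun h' => ⟨h, h'.2⟩⟩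

/-- **The split (3.46) at the bond `b_ι = (0, e_ι)`**:
`{0 ↔ x through {e}} = {b occupied and pivotal for 0 → x} ⊔ {0 ↔ x through {e} in ω ∖ b}`.
[cite: FitznerVanDerHofstad2017, (3.46) (arXiv:1506.07977v2 p. 29)] -/
theorem connThrough_singleton_eq_union {e : Site d} (he : (zdGraph d).Adj 0 e) (x : Site d) :
    connThrough {e} 0 x =
      ({ω | s(0, e) ∈ ω} ∩ {ω | IsPivotalBond ω 0 x 0 e}) ∪ occursOff {s(0, e)} (connThrough {e} 0 x) := by
  ext ω
  rw [Set.mem_union, mem_occursOff_iff, show offBonds {s(0, e)} ω = ω \ {s(0, e)} from rfl]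
  constructor
  · intro hω
    have hω1 : ω ∈ openConn 0 x := ((mem_connThrough_iff _ _ _ _).1 hω).1
    by_cases h : ω \ {s(0, e)} ∈ openConn 0 x
    · exact Or.inr ((connThrough_singleton_sdiff_iff x h).2 hω)
    · left
      have hx : x ∉ restrCluster 0 e 0 ω := fun hx => h hx
      have hb : s(0, e) ∈ ω := by
        by_contra hb
        exact h (by rwa [Set.sdiff_singleton_eq_self hb])
      obtain ⟨a, b', ha, -, hb', hadj, hpath⟩ :=
        (pathIn_univ_iff_reachable.2 hω1).last_exit (self_mem_restrCluster 0 e 0 ω) hx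
      have hab := edge_eq_of_adj_of_mem_restrCluster ha hb' hadj
      have hb'e : b' = e := by
        rcases Sym2.eq_iff.1 hab with ⟨-, h2⟩ | ⟨-, h2⟩
        · exact h2
        · exact absurd (h2 ▸ self_mem_restrCluster 0 e 0 ω) hb'
      subst hb'e
      exact Set.mem_inter hb ⟨he, self_mem_restrCluster 0 _ 0 ω,
        mem_openConnIn_of_pathIn (by rwa [Set.compl_eq_univ_sdiff])⟩
  · rintro (⟨hb, hpiv⟩ | hω)
    · have he' : (openGraph ω).Adj 0 e := (openGraph_adj ω 0 e).2 ⟨hb, he.ne⟩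
      rw [mem_connThrough_iff]
      refine ⟨he'.reachable.trans (pathIn_univ_iff_reachable.1
        ((pathIn_of_mem_openConnIn hpiv.2.2).mono (Set.subset_univ _))), fun hin => hpiv.notMem_target ?_⟩
      have h2 := (openConnIn_sdiff_iff_of_notMem ω (B := ({e} : Set (Site d))ᶜ) (a := e) (b := 0) (by simp)).2 hin
      rw [← Sym2.eq_swap] at h2
      exact pathIn_univ_iff_reachable.1 ((pathIn_of_mem_openConnIn h2).mono (Set.subset_univ _))
    · exact (connThrough_singleton_sdiff_iff x ((mem_connThrough_iff _ _ _ _).1 hω).1).1 hω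

/-- **(3.46) in measure**: `P(0 ↔ x through {e}) = P(b occupied and pivotal for 0 → x) + P^{b}(0 ↔ x through {e})`.
[cite: FitznerVanDerHofstad2017, (3.46) (arXiv:1506.07977v2 p. 29)] -/
theorem measure_connThrough_singleton_eq_add (p : unitInterval) {e : Site d} (he : (zdGraph d).Adj 0 e)
    (x : Site d) :
    bondPercolation (zdGraph d) p (connThrough {e} 0 x) =
      bondPercolation (zdGraph d) p ({ω | s(0, e) ∈ ω} ∩ {ω | IsPivotalBond ω 0 x 0 e} ∩ laceE {0} 0 0) +
        probOff d p {s(0, e)} (connThrough {e} 0 x) := by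
  rw [laceE_self_eq_univ (Set.mem_singleton 0), Set.inter_univ, probOff_def]
  conv_lhs => rw [connThrough_singleton_eq_union he x]
  refine measure_union ?_ ((measurable_offBonds {s(0, e)}) (measurableSet_connThrough {e} 0 x))
  rw [Set.disjoint_left]
  rintro ω ⟨-, hpiv⟩ hω
  exact hpiv.notMem_target ((mem_connThrough_iff _ _ _ _).1 hω).1

/-- **(3.45)**: `τ(x) = τ^ι(x) + P(0 ↔ x through {e_ι})` (in `[0,∞]`).
[cite: FitznerVanDerHofstad2017, (3.46), first equality (arXiv:1506.07977v2 p. 29)] -/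
theorem ofReal_tau_eq_add (p : unitInterval) {e : Site d} (he0 : e ≠ 0) (x : Site d) :
    ENNReal.ofReal (tau d p 0 x) =
      ENNReal.ofReal (tauOff d p e x) + bondPercolation (zdGraph d) p (connThrough {e} 0 x) := by
  have hset : openConnIn ({e} : Set (Site d))ᶜ 0 x = occursOff (bondsAt {e}) (openConn 0 x) := by
    have h := occursOff_openConnIn_compl_eq (B := bondsAt {e}) (A' := {e}) (S := ∅) (u' := 0)
      subset_rfl (by rw [Set.empty_union])
      (fun h : (0 : Site d) ∈ ({e} : Set (Site d)) => he0 (Set.mem_singleton_iff.1 h).symm) x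
    rw [Set.empty_union, Set.compl_empty] at h
    rw [← h]
    congr 1
    ext ω
    rw [mem_openConnIn_iff_pathIn, pathIn_univ_iff_reachable]
    rfl
  rw [tau_def, measureReal_def, ENNReal.ofReal_toReal (measure_ne_top _ _), measure_openConn_eq_add p {e} 0 x,
    ← probOff_bondsAt_openConn_eq_ofReal_tauOff, probOff_def, hset]

/-- **The pivotal term of (3.46)–(3.47) plus the through-term of the inner expansion**:
`P(b occ. & pivotal for 0 → x) + p 𝔼_0^{b}[𝟙{e ∉ C̃} P^{B(0)}(e ↔ x through C̃)] = p P(e ∉ C̃^{b}(0)) τ^{-e}(x - e)`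
(cutting-bond lemma at `b`, then `τ^{B(0)}` split as `P(e ↔ x in ℤ^d ∖ C̃) + P^{B(0)}(e ↔ x through C̃)` on `{e ∉ C̃}`,
`0 ∈ C̃`). [cite: FitznerVanDerHofstad2017, (3.47)–(3.50) (arXiv:1506.07977v2 p. 29), (3.55)–(3.57) (p. 30)] -/
theorem measure_pivotal_add_nobleIotaCorr_eq {p : unitInterval} (hp : (p : ℝ) < criticalProb (zdGraph d) (0 : Site d))
    {e : Site d} (he : (zdGraph d).Adj 0 e) (x : Site d) :
    bondPercolation (zdGraph d) p ({ω | s(0, e) ∈ ω} ∩ {ω | IsPivotalBond ω 0 x 0 e} ∩ laceE {0} 0 0) +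
        ENNReal.ofReal p * nobleIotaCorr d p e (fun C => nobleKerThrough d p 0 C e x) =
      ENNReal.ofReal p * bondPercolation (zdGraph d) p {ω | e ∉ restrCluster 0 e 0 ω} *
        ENNReal.ofReal (tauOff d p (-e) (x - e)) := by
  have hS : MeasurableSet {ω : BondConfig (Site d) | e ∉ restrCluster 0 e 0 ω} := by
    simpa only [restrCluster_offBonds_self] using measurableSet_notMem_restrCluster (d := d) e
  have hg : Measurable fun ω : BondConfig (Site d) => {ω : BondConfig (Site d) | e ∉ restrCluster 0 e 0 ω}.indicator
      (fun ω => nobleKerThrough d p 0 (restrCluster 0 e 0 ω) e x) ω :=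
    ((nobleKerThrough_measurable p 0 e x).comp (measurable_restrCluster 0 e 0)).indicator hS
  rw [measure_cut_eq hp he {0} 0 x, nobleIotaCorr_eq, ← mul_add, mul_assoc,
    mul_comm (bondPercolation (zdGraph d) p {ω | e ∉ restrCluster 0 e 0 ω}) _,
    ← lintegral_indicator_const hS, ← lintegral_add_right _ hg]
  congr 1
  refine lintegral_congr fun ω => ?_
  rw [laceE_self_eq_univ (Set.mem_singleton 0), Set.indicator_univ]
  by_cases hω : e ∈ restrCluster 0 e 0 ω
  · have h1 : ω ∉ {ω : BondConfig (Site d) | e ∉ restrCluster 0 e 0 ω} := fun h => h hω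
    rw [Set.indicator_of_notMem h1, Set.indicator_of_notMem h1, add_zero, openConnIn_compl_eq_empty_of_mem hω,
      measure_empty]
  · have h1 : ω ∈ {ω : BondConfig (Site d) | e ∉ restrCluster 0 e 0 ω} := hω
    rw [Set.indicator_of_mem h1, Set.indicator_of_mem h1]
    have h2 := ofReal_tauOff_eq_add p (self_mem_restrCluster 0 e 0 ω) e x
    rw [zero_sub] at h2
    exact h2.symm

/-- `p · P(e_ι ∉ C̃^{b_ι}(0)) = μ_p` for every direction `ι`. [cite: FitznerVanDerHofstad2017, (3.42) (arXiv:1506.07977v2 p. 28), (3.49)–(3.50) (p. 29)] -/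
theorem ofReal_mul_measure_stepVec_notMem (hd : 1 ≤ d) (p : unitInterval) (hp : (p : ℝ) < 1) (ι : Fin d × Bool) :
    ENNReal.ofReal p * bondPercolation (zdGraph d) p
        {ω | Percolation.stepVec ι ∉ restrCluster 0 (Percolation.stepVec ι) 0 ω} = ENNReal.ofReal (nobleMu d p) := by
  have h := noblePsiBT_empty_origin p (Percolation.stepVec (srev ι))
  rw [show -Percolation.stepVec (srev ι) = Percolation.stepVec ι by rw [stepVec_srev, neg_neg]] at h
  rw [← h]
  exact ofReal_mul_noblePsiBT_empty_origin hd p hp (srev ι)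

/-- Additivity of the correction functional `G ↦ 𝔼_0^{b}[𝟙{e ∉ C̃} G(C̃)]` for measurable `G`.
[cite: FitznerVanDerHofstad2017, (3.55)–(3.57) (arXiv:1506.07977v2 p. 30)] -/
theorem nobleIotaCorr_add (p : unitInterval) (e : Site d) {G₁ G₂ : Set (Site d) → ℝ≥0∞} (h₁ : Measurable G₁)
    (h₂ : Measurable G₂) :
    nobleIotaCorr d p e (fun C => G₁ C + G₂ C) = nobleIotaCorr d p e G₁ + nobleIotaCorr d p e G₂ := by
  unfold nobleIotaCorr
  have hS := measurableSet_notMem_restrCluster (d := d) e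
  have hm : Measurable fun ω : BondConfig (Site d) =>
      {ω : BondConfig (Site d) | e ∉ restrCluster 0 e 0 (offBonds {s(0, e)} ω)}.indicator
        (fun ω => G₁ (restrCluster 0 e 0 (offBonds {s(0, e)} ω))) ω :=
    (h₁.comp ((measurable_restrCluster 0 e 0).comp (measurable_offBonds {s(0, e)}))).indicator hS
  have _h₂ := h₂
  rw [← lintegral_add_left hm]
  refine lintegral_congr fun ω => ?_
  by_cases hω : ω ∈ {ω : BondConfig (Site d) | e ∉ restrCluster 0 e 0 (offBonds {s(0, e)} ω)}
  · simp only [Set.indicator_of_mem hω]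
  · simp only [Set.indicator_of_notMem hω, add_zero]

/-- Measurability of the inner transfer term `C ↦ Σ_u Σ_κ p Ψ^{B(0),(n),κ}(e,u;C) τ^κ(x-u+e_κ)`.
[cite: FitznerVanDerHofstad2017, (3.56) (arXiv:1506.07977v2 p. 30)] -/
theorem measurable_transfer_bondsAt (p : unitInterval) (n : ℕ) (e x : Site d) :
    Measurable fun C : Set (Site d) => ∑' u, ∑ κ : Fin d × Bool, ENNReal.ofReal p *
      noblePsiBT d p (bondsAt {0}) {0} (Percolation.stepVec κ) n C e u *
        ENNReal.ofReal (tauOff d p (Percolation.stepVec κ) (x - u + Percolation.stepVec κ)) :=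
  Measurable.tsum fun u => Finset.measurable_sum _ fun _ _ =>
    ((noblePsiBT_measurable p _ _ _ n e u).const_mul _).mul_const _

/-- The correction functional commutes with the transfer sum:
`𝔼_0^{b}[𝟙 Σ_uΣ_κ pΨ^{B(0),(n),κ}(e,u;C̃)τ^κ] = Σ_uΣ_κ p 𝔼_0^{b}[𝟙 Ψ^{B(0),(n),κ}(e,u;C̃)] τ^κ` (recognising (3.56)).
[cite: FitznerVanDerHofstad2017, (3.56) (arXiv:1506.07977v2 p. 30)] -/
theorem nobleIotaCorr_transfer_eq (p : unitInterval) (n : ℕ) (e x : Site d) :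
    nobleIotaCorr d p e (fun C => ∑' u, ∑ κ : Fin d × Bool, ENNReal.ofReal p *
        noblePsiBT d p (bondsAt {0}) {0} (Percolation.stepVec κ) n C e u *
          ENNReal.ofReal (tauOff d p (Percolation.stepVec κ) (x - u + Percolation.stepVec κ))) =
      ∑' u, ∑ κ : Fin d × Bool, ENNReal.ofReal p *
        nobleIotaCorr d p e (fun C => noblePsiBT d p (bondsAt {0}) {0} (Percolation.stepVec κ) n C e u) *
          ENNReal.ofReal (tauOff d p (Percolation.stepVec κ) (x - u + Percolation.stepVec κ)) := by
  have h := nobleIotaCorr_tsum_mul p e (fun i : Site d × (Fin d × Bool) => nobleTC d p i x)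
    (G := fun i C => noblePsiBT d p (bondsAt {0}) {0} (Percolation.stepVec i.2) n C e i.1)
    (fun i => noblePsiBT_measurable p _ _ _ n e i.1)
  rw [tsum_nobleTC_mul p (fun e' u => nobleIotaCorr d p e
    (fun C => noblePsiBT d p (bondsAt {0}) {0} e' n C e u)) x] at h
  rw [← h]
  congr 1
  funext C
  exact (tsum_nobleTC_mul p (fun e' u => noblePsiBT d p (bondsAt {0}) {0} e' n C e u) x).symm

/-- The inner-level sequence of §3.3: `G_0(C) = P^{B(0)}(e ↔ x through C)`, `G_{n+1}(C) = |R^{B(0)}_n|(e,x;C)`.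
[cite: FitznerVanDerHofstad2017, (3.55)–(3.57) (arXiv:1506.07977v2 p. 30)] -/
def nobleInnerSeq (d : ℕ) (p : unitInterval) (e x : Site d) : ℕ → Set (Site d) → ℝ≥0∞
  | 0 => fun C => nobleKerThrough d p 0 C e x
  | n + 1 => fun C => nobleRBT d p (bondsAt {0}) {0} n C e x

/-- Measurability of the inner-level sequence. [cite: FitznerVanDerHofstad2017, (3.33), (3.57) (arXiv:1506.07977v2 pp. 27, 30)] -/
theorem nobleInnerSeq_measurable (p : unitInterval) (e x : Site d) : ∀ n, Measurable (nobleInnerSeq d p e x n)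
  | 0 => nobleKerThrough_measurable p 0 e x
  | n + 1 => nobleRBT_measurable p _ _ n e x

/-- The inner expansion identities (Lemma 3.3 with outer data `(B(0), {0})`, start `e ≠ 0`, `A = C`):
`G_n(C) + |R^{B(0)}_n|(e,x;C) = Ξ^{B(0),(n)}(e,x;C) + Σ_uΣ_κ pΨ^{B(0),(n),κ}(e,u;C)τ^κ(x-u+e_κ)`.
[cite: FitznerVanDerHofstad2017, (3.21)–(3.33) (arXiv:1506.07977v2 pp. 25–27), (3.55)–(3.57) (p. 30)] -/
theorem nobleInnerSeq_add_eq {p : unitInterval} (hp : (p : ℝ) < criticalProb (zdGraph d) (0 : Site d))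
    {e : Site d} (he0 : e ≠ 0) (x : Site d) : ∀ (n : ℕ) (C : Set (Site d)),
    nobleInnerSeq d p e x n C + nobleRBT d p (bondsAt {0}) {0} n C e x =
      nobleXiBT d p (bondsAt {0}) {0} n C e x + ∑' u, ∑ κ : Fin d × Bool, ENNReal.ofReal p *
        noblePsiBT d p (bondsAt {0}) {0} (Percolation.stepVec κ) n C e u *
          ENNReal.ofReal (tauOff d p (Percolation.stepVec κ) (x - u + Percolation.stepVec κ))
  | 0, C => by
      rw [show nobleInnerSeq d p e x 0 C = probOff d p (bondsAt {0}) (connThrough C e x) from rfl]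
      exact probOff_connThrough_add_nobleRBT_zero hp C x (B := bondsAt {0}) (A' := {0}) (v := e) subset_rfl
        (bondsAt_mono (Set.subset_insert _ _)) (fun u u' hb => nobleCell_bondsAt_eq_empty_of_ne he0 C hb)
  | n + 1, C => nobleRBT_add_succ hp (bondsAt {0}) {0} n C e x

/-- The inner identities integrated against `𝔼_0^{b}[𝟙{e ∉ C̃} ·]`.
[cite: FitznerVanDerHofstad2017, (3.55)–(3.57) (arXiv:1506.07977v2 p. 30)] -/
theorem nobleIotaCorr_innerSeq_add_eq {p : unitInterval} (hp : (p : ℝ) < criticalProb (zdGraph d) (0 : Site d))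
    {e : Site d} (he0 : e ≠ 0) (x : Site d) (n : ℕ) :
    nobleIotaCorr d p e (nobleInnerSeq d p e x n) +
        nobleIotaCorr d p e (fun C => nobleRBT d p (bondsAt {0}) {0} n C e x) =
      nobleIotaCorr d p e (fun C => nobleXiBT d p (bondsAt {0}) {0} n C e x) +
        ∑' u, ∑ κ : Fin d × Bool, ENNReal.ofReal p *
          nobleIotaCorr d p e (fun C => noblePsiBT d p (bondsAt {0}) {0} (Percolation.stepVec κ) n C e u) *
            ENNReal.ofReal (tauOff d p (Percolation.stepVec κ) (x - u + Percolation.stepVec κ)) := by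
  rw [← nobleIotaCorr_transfer_eq,
    ← nobleIotaCorr_add p e (nobleInnerSeq_measurable p e x n) (nobleRBT_measurable p _ _ n e x),
    ← nobleIotaCorr_add p e (nobleXiBT_measurable p _ _ n e x) (measurable_transfer_bondsAt p n e x)]
  congr 1
  funext C
  exact nobleInnerSeq_add_eq hp he0 x n C


/-- **Level `0` of the `ι`-expansion**: with `t = P(0 ↔ x through {e})`, `u_0 = |R^{b}_0|(0,x;{e}) + p𝔼^b_0[𝟙 G_0(C̃)]`,
`c = p P(e ∉ C̃^b(0)) τ^{-e}(x-e)`, `a_0 = Ξ^{(0),ι}(x) + Σ_yΣ_κ Π^{(0),ι,κ}(y)τ^κ(x-y+e_κ)`: `t + u_0 = c + a_0`.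
[cite: FitznerVanDerHofstad2017, (3.46)–(3.54) (arXiv:1506.07977v2 p. 29)] -/
theorem noble_iota_level_zero_eq {p : unitInterval} (hp : (p : ℝ) < criticalProb (zdGraph d) (0 : Site d))
    {e : Site d} (he : (zdGraph d).Adj 0 e) (x : Site d) :
    bondPercolation (zdGraph d) p (connThrough {e} 0 x) +
        (nobleRBT d p {s(0, e)} ∅ 0 {e} 0 x + ENNReal.ofReal p * nobleIotaCorr d p e (nobleInnerSeq d p e x 0)) =
      ENNReal.ofReal p * bondPercolation (zdGraph d) p {ω | e ∉ restrCluster 0 e 0 ω} *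
          ENNReal.ofReal (tauOff d p (-e) (x - e)) +
        (nobleXiIotaT d p e 0 x + ∑' y, ∑ κ : Fin d × Bool, noblePiT d p e (Percolation.stepVec κ) 0 y *
          ENNReal.ofReal (tauOff d p (Percolation.stepVec κ) (x - y + Percolation.stepVec κ))) := by
  have he0 : e ≠ 0 := he.ne.symm
  have hsplit := measure_connThrough_singleton_eq_add p he x
  have hpiv : bondPercolation (zdGraph d) p ({ω | s(0, e) ∈ ω} ∩ {ω | IsPivotalBond ω 0 x 0 e} ∩ laceE {0} 0 0) +
      ENNReal.ofReal p * nobleIotaCorr d p e (nobleInnerSeq d p e x 0) =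
        ENNReal.ofReal p * bondPercolation (zdGraph d) p {ω | e ∉ restrCluster 0 e 0 ω} *
          ENNReal.ofReal (tauOff d p (-e) (x - e)) := measure_pivotal_add_nobleIotaCorr_eq hp he x
  have hBc : ∀ u u', s(u, u') ∈ ({s(0, e)} : Set (Sym2 (Site d))) → nobleCell {s(0, e)} ∅ {e} 0 u u' = ∅ := by
    intro u u' hb
    rw [Set.mem_singleton_iff] at hb
    rw [Set.eq_empty_iff_forall_notMem]
    intro ω hω
    rw [mem_nobleCell_iff] at hω
    rcases Sym2.eq_iff.1 hb with ⟨hu, -⟩ | ⟨hu, hu'⟩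
    · rw [hu] at hω
      have h1 := ((mem_connThrough_iff _ _ _ _).1 (connThrough_of_mem_laceE hω.1)).2
      exact h1 (mem_openConnIn_self_iff.2 (fun h : (0 : Site d) ∈ ({e} : Set (Site d)) =>
        he0 (Set.mem_singleton_iff.1 h).symm))
    · rw [hu, hu'] at hω
      exact hω.2 (Or.inl (self_mem_restrCluster e 0 0 _))
  have hout := probOff_connThrough_add_nobleRBT_zero hp {e} x (B := {s(0, e)}) (A' := ∅) (v := 0)
    (by rw [bondsAt_empty]; exact Set.empty_subset _)
    (fun b hb => by
      rw [Set.mem_singleton_iff.1 hb]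
      exact bondsAt_mono (Set.singleton_subset_iff.2 (Set.mem_insert 0 ∅))
        ((mem_bondsAt_singleton_iff 0 _).2 (Sym2.mem_mk_left 0 e)))
    hBc
  calc bondPercolation (zdGraph d) p (connThrough {e} 0 x) +
        (nobleRBT d p {s(0, e)} ∅ 0 {e} 0 x + ENNReal.ofReal p * nobleIotaCorr d p e (nobleInnerSeq d p e x 0))
      = (bondPercolation (zdGraph d) p ({ω | s(0, e) ∈ ω} ∩ {ω | IsPivotalBond ω 0 x 0 e} ∩ laceE {0} 0 0) +
            ENNReal.ofReal p * nobleIotaCorr d p e (nobleInnerSeq d p e x 0)) +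
          (probOff d p {s(0, e)} (connThrough {e} 0 x) + nobleRBT d p {s(0, e)} ∅ 0 {e} 0 x) := by
        rw [hsplit]; ring
    _ = _ := by rw [hpiv, hout]; rfl

/-- **Level `n + 1` of the `ι`-expansion**: `u_n + u_{n+1} = a_{n+1}` with
`u_n = |R^{b}_n|(0,x;{e}) + p𝔼^b_0[𝟙 G_n(C̃)]` (so `u_{n+1} = nobleRIotaT (n+1)`), `a_N = Ξ^{(N),ι}(x) + Σ_yΣ_κΠ^{(N),ι,κ}(y)τ^κ`.
[cite: FitznerVanDerHofstad2017, (3.50)–(3.57) (arXiv:1506.07977v2 pp. 29–30)] -/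
theorem noble_iota_level_succ_eq {p : unitInterval} (hp : (p : ℝ) < criticalProb (zdGraph d) (0 : Site d))
    {e : Site d} (he0 : e ≠ 0) (x : Site d) (n : ℕ) :
    (nobleRBT d p {s(0, e)} ∅ n {e} 0 x + ENNReal.ofReal p * nobleIotaCorr d p e (nobleInnerSeq d p e x n)) +
        (nobleRBT d p {s(0, e)} ∅ (n + 1) {e} 0 x +
          ENNReal.ofReal p * nobleIotaCorr d p e (nobleInnerSeq d p e x (n + 1))) =
      nobleXiIotaT d p e (n + 1) x + ∑' y, ∑ κ : Fin d × Bool, noblePiT d p e (Percolation.stepVec κ) (n + 1) y *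
        ENNReal.ofReal (tauOff d p (Percolation.stepVec κ) (x - y + Percolation.stepVec κ)) := by
  have hout := nobleRBT_add_succ hp {s(0, e)} ∅ n {e} 0 x
  have hin := nobleIotaCorr_innerSeq_add_eq hp he0 x n
  calc (nobleRBT d p {s(0, e)} ∅ n {e} 0 x + ENNReal.ofReal p * nobleIotaCorr d p e (nobleInnerSeq d p e x n)) +
        (nobleRBT d p {s(0, e)} ∅ (n + 1) {e} 0 x +
          ENNReal.ofReal p * nobleIotaCorr d p e (nobleInnerSeq d p e x (n + 1)))
      = (nobleRBT d p {s(0, e)} ∅ n {e} 0 x + nobleRBT d p {s(0, e)} ∅ (n + 1) {e} 0 x) +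
          ENNReal.ofReal p * (nobleIotaCorr d p e (nobleInnerSeq d p e x n) +
            nobleIotaCorr d p e (fun C => nobleRBT d p (bondsAt {0}) {0} n C e x)) := by
        rw [show nobleInnerSeq d p e x (n + 1) = fun C => nobleRBT d p (bondsAt {0}) {0} n C e x from rfl]; ring
    _ = (nobleXiBT d p {s(0, e)} ∅ (n + 1) {e} 0 x + ∑' u, ∑ κ : Fin d × Bool, ENNReal.ofReal p *
            noblePsiBT d p {s(0, e)} ∅ (Percolation.stepVec κ) (n + 1) {e} 0 u *
              ENNReal.ofReal (tauOff d p (Percolation.stepVec κ) (x - u + Percolation.stepVec κ))) +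
          ENNReal.ofReal p * (nobleIotaCorr d p e (fun C => nobleXiBT d p (bondsAt {0}) {0} n C e x) +
            ∑' u, ∑ κ : Fin d × Bool, ENNReal.ofReal p *
              nobleIotaCorr d p e (fun C => noblePsiBT d p (bondsAt {0}) {0} (Percolation.stepVec κ) n C e u) *
                ENNReal.ofReal (tauOff d p (Percolation.stepVec κ) (x - u + Percolation.stepVec κ))) := by
        rw [hout, hin]
    _ = _ := by
        show _ = (nobleXiBT d p {s(0, e)} ∅ (n + 1) {e} 0 x +
            ENNReal.ofReal p * nobleIotaCorr d p e (fun C => nobleXiBT d p (bondsAt {0}) {0} n C e x)) +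
          ∑' y, ∑ κ : Fin d × Bool, (ENNReal.ofReal p * noblePsiBT d p {s(0, e)} ∅ (Percolation.stepVec κ) (n + 1) {e} 0 y +
            ENNReal.ofReal p ^ 2 * nobleIotaCorr d p e
              (fun C => noblePsiBT d p (bondsAt {0}) {0} (Percolation.stepVec κ) n C e y)) *
            ENNReal.ofReal (tauOff d p (Percolation.stepVec κ) (x - y + Percolation.stepVec κ))
        rw [mul_add, add_add_add_comm, ← ENNReal.tsum_mul_left, ← ENNReal.tsum_add]
        congr 1
        refine tsum_congr fun y => ?_
        rw [Finset.mul_sum, ← Finset.sum_add_distrib]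
        refine Finset.sum_congr rfl fun κ _ => ?_
        ring

/-- Alternating telescoping in `[0,∞]` → `ℝ` with a constant term at level `0`. [folklore] -/
theorem toReal_eq_alternating_of_add' {t c : ℝ≥0∞} {a r : ℕ → ℝ≥0∞} (ht : t ≠ ∞) (hc : c ≠ ∞) (hr : ∀ n, r n ≠ ∞)
    (h0 : t + r 0 = c + a 0) (hsucc : ∀ n, r n + r (n + 1) = a (n + 1)) (M : ℕ) :
    t.toReal = c.toReal + ∑ N ∈ Finset.range (M + 1), (-1 : ℝ) ^ N * (a N).toReal +
      (-1 : ℝ) ^ (M + 1) * (r M).toReal := by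
  induction M with
  | zero =>
    have ha : a 0 ≠ ∞ := fun h => by
      rw [h, add_top] at h0
      exact ENNReal.add_ne_top.2 ⟨ht, hr 0⟩ h0
    have h := congrArg ENNReal.toReal h0
    rw [ENNReal.toReal_add ht (hr 0), ENNReal.toReal_add hc ha] at h
    simp only [zero_add, Finset.range_one, Finset.sum_singleton, pow_zero, one_mul, pow_one]
    linarith
  | succ M ih =>
    have ha : (a (M + 1)).toReal = (r M).toReal + (r (M + 1)).toReal := by
      rw [← hsucc M, ENNReal.toReal_add (hr M) (hr (M + 1))]
    rw [Finset.sum_range_succ, ha, ih, pow_succ, pow_succ]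
    ring

/-- **The `ι`-expansion at finite `M` in `[0,∞]`-to-`ℝ` form**:
`P(0 ↔ x through {e}) = p P(e ∉ C̃^b(0)) τ^{-e}(x-e) + Σ_{N≤M} (-1)^N a_N + (-1)^{M+1} u_M`.
[cite: FitznerVanDerHofstad2017, (3.46)–(3.57) (arXiv:1506.07977v2 pp. 29–30)] -/
theorem measure_connThrough_toReal_eq_alternating (hd : 2 ≤ d) {p : unitInterval} (hp : p < criticalProbI d)
    {e : Site d} (he : (zdGraph d).Adj 0 e) (M : ℕ) (x : Site d) :
    (bondPercolation (zdGraph d) p (connThrough {e} 0 x)).toReal =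
      (ENNReal.ofReal p * bondPercolation (zdGraph d) p {ω | e ∉ restrCluster 0 e 0 ω} *
          ENNReal.ofReal (tauOff d p (-e) (x - e))).toReal +
        ∑ N ∈ Finset.range (M + 1), (-1 : ℝ) ^ N * (nobleXiIotaT d p e N x +
          ∑' y, ∑ κ : Fin d × Bool, noblePiT d p e (Percolation.stepVec κ) N y *
            ENNReal.ofReal (tauOff d p (Percolation.stepVec κ) (x - y + Percolation.stepVec κ))).toReal +
        (-1 : ℝ) ^ (M + 1) * (nobleRBT d p {s(0, e)} ∅ M {e} 0 x +
          ENNReal.ofReal p * nobleIotaCorr d p e (nobleInnerSeq d p e x M)).toReal := by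
  have hpR := coe_lt_criticalProb_of_lt hp
  have he0 : e ≠ 0 := he.ne.symm
  have hr : ∀ n, nobleRBT d p {s(0, e)} ∅ n {e} 0 x +
      ENNReal.ofReal p * nobleIotaCorr d p e (nobleInnerSeq d p e x n) ≠ ∞ := by
    intro n
    refine ENNReal.add_ne_top.2 ⟨nobleRBT_ne_top hd _ _ n _ _ _ hp, ENNReal.mul_ne_top ENNReal.ofReal_ne_top ?_⟩
    cases n with
    | zero => exact nobleIotaCorr_ne_top_of_le ENNReal.one_ne_top fun C => probOff_le_one p _ _
    | succ n => exact nobleIotaCorr_ne_top_of_le (nobleLevelBound_ne_top p (n + 1)) fun C =>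
        nobleRBT_le_bound hd le_rfl hpR _ _ n C e x
  exact toReal_eq_alternating_of_add'
    (a := fun N => nobleXiIotaT d p e N x + ∑' y, ∑ κ : Fin d × Bool, noblePiT d p e (Percolation.stepVec κ) N y *
      ENNReal.ofReal (tauOff d p (Percolation.stepVec κ) (x - y + Percolation.stepVec κ)))
    (r := fun n => nobleRBT d p {s(0, e)} ∅ n {e} 0 x + ENNReal.ofReal p * nobleIotaCorr d p e (nobleInnerSeq d p e x n))
    (measure_ne_top _ _) (ENNReal.mul_ne_top (ENNReal.mul_ne_top ENNReal.ofReal_ne_top (measure_ne_top _ _))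
      ENNReal.ofReal_ne_top) hr (noble_iota_level_zero_eq hpR he x) (fun n => noble_iota_level_succ_eq hpR he0 x n) M

/-- The real `y`-sum of (2.15) at level `N`: `Σ_y Π^{(N),ι,κ}(y) τ^{κ'}(x - y + e')` converges (`p < p_c`).
[cite: FitznerVanDerHofstad2017, (3.34)–(3.35), (3.53), (3.56) (arXiv:1506.07977v2 pp. 27, 30)] -/
theorem summable_noblePiN_mul_tauOff (hd : 2 ≤ d) {p : unitInterval} (hp : p < criticalProbI d) (e e' e'' : Site d)
    (N : ℕ) (x : Site d) : Summable (fun y => noblePiN d p e e' N y * tauOff d p e'' (x - y + e'')) :=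
  (summable_weighted_noblePiN hd hp e e' N (fun y => tauOff d p e'' (x - y + e''))
    (fun y => abs_le.2 ⟨by linarith [tauOff_nonneg p e'' (x - y + e'')], tauOff_le_one p _ _⟩)).congr
    fun y => mul_comm _ _

/-- The level-`N` term of (3.49) in real form: `(Ξ^{(N),ι} + Σ_yΣ_κ Π^{(N),ι,κ} τ^κ).toReal = Ξ^{(N),ι}(x) + Σ_yΣ_κ Π^{(N),ι,κ}(y)τ^κ(x-y+e_κ)`.
[cite: FitznerVanDerHofstad2017, (3.52)–(3.54) (arXiv:1506.07977v2 p. 29), (3.55)–(3.56) (p. 30)] -/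
theorem toReal_iota_level_eq (hd : 2 ≤ d) {p : unitInterval} (hp : p < criticalProbI d) (e : Site d) (N : ℕ)
    (x : Site d) :
    (nobleXiIotaT d p e N x + ∑' y, ∑ κ : Fin d × Bool, noblePiT d p e (Percolation.stepVec κ) N y *
        ENNReal.ofReal (tauOff d p (Percolation.stepVec κ) (x - y + Percolation.stepVec κ))).toReal =
      nobleXiIotaN d p e N x + ∑' y, ∑ κ : Fin d × Bool, noblePiN d p e (Percolation.stepVec κ) N y *
        tauOff d p (Percolation.stepVec κ) (x - y + Percolation.stepVec κ) := by
  have hnn : ∀ (y : Site d) (κ : Fin d × Bool), 0 ≤ noblePiN d p e (Percolation.stepVec κ) N y *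
      tauOff d p (Percolation.stepVec κ) (x - y + Percolation.stepVec κ) :=
    fun y κ => mul_nonneg (noblePiN_nonneg p _ _ N y) (tauOff_nonneg p _ _)
  have hterm : ∀ (y : Site d) (κ : Fin d × Bool), noblePiT d p e (Percolation.stepVec κ) N y *
      ENNReal.ofReal (tauOff d p (Percolation.stepVec κ) (x - y + Percolation.stepVec κ)) =
        ENNReal.ofReal (noblePiN d p e (Percolation.stepVec κ) N y *
          tauOff d p (Percolation.stepVec κ) (x - y + Percolation.stepVec κ)) := by
    intro y κ
    rw [noblePiN, ENNReal.ofReal_mul ENNReal.toReal_nonneg, ENNReal.ofReal_toReal (ne_top_of_le_ne_top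
      (ENNReal.mul_ne_top ENNReal.ofReal_ne_top (nobleXiIotaT_ne_top hd hp e N y)) (noblePiT_le p e _ N y))]
  rw [ENNReal.toReal_add (nobleXiIotaT_ne_top hd hp e N x) (tsum_noblePiT_tauOff_ne_top hd hp e N x), nobleXiIotaN]
  congr 1
  simp_rw [hterm]
  calc (∑' y, ∑ κ : Fin d × Bool, ENNReal.ofReal (noblePiN d p e (Percolation.stepVec κ) N y *
          tauOff d p (Percolation.stepVec κ) (x - y + Percolation.stepVec κ))).toReal
      = (∑' y, ENNReal.ofReal (∑ κ : Fin d × Bool, noblePiN d p e (Percolation.stepVec κ) N y *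
          tauOff d p (Percolation.stepVec κ) (x - y + Percolation.stepVec κ))).toReal := by
        rw [tsum_congr fun y => (ENNReal.ofReal_sum_of_nonneg fun κ _ => hnn y κ).symm]
    _ = _ := by
        rw [← ENNReal.ofReal_tsum_of_nonneg (fun y => Finset.sum_nonneg fun κ _ => hnn y κ)
          (summable_sum fun κ _ => summable_noblePiN_mul_tauOff hd hp e _ _ N x),
          ENNReal.toReal_ofReal (tsum_nonneg fun y => Finset.sum_nonneg fun κ _ => hnn y κ)]

/-- Interchange of the finite alternating `N`-sum with the `y`-sum for the `Π`-coefficients: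
`Σ_{N≤M} (-1)^N Σ_yΣ_κ Π^{(N),ι,κ}(y)τ^κ(…) = Σ_yΣ_κ Π^{ι,κ}_M(y)τ^κ(…)`. [cite: FitznerVanDerHofstad2017, (2.16) (arXiv:1506.07977v2 p. 11; EJP 22 (2017) no. 43 p. 10), (3.52) (arXiv v2 p. 29)] -/
theorem sum_alternating_pi_transfer_eq (hd : 2 ≤ d) {p : unitInterval} (hp : p < criticalProbI d) (e : Site d)
    (M : ℕ) (x : Site d) :
    ∑ N ∈ Finset.range (M + 1), (-1 : ℝ) ^ N * ∑' y, ∑ κ : Fin d × Bool, noblePiN d p e (Percolation.stepVec κ) N y *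
        tauOff d p (Percolation.stepVec κ) (x - y + Percolation.stepVec κ) =
      ∑' y, ∑ κ : Fin d × Bool, noblePiM d p e (Percolation.stepVec κ) M y *
        tauOff d p (Percolation.stepVec κ) (x - y + Percolation.stepVec κ) := by
  have hs : ∀ N ∈ Finset.range (M + 1), Summable fun y => (-1 : ℝ) ^ N * ∑ κ : Fin d × Bool,
      noblePiN d p e (Percolation.stepVec κ) N y * tauOff d p (Percolation.stepVec κ) (x - y + Percolation.stepVec κ) :=
    fun N _ => (summable_sum fun κ _ => summable_noblePiN_mul_tauOff hd hp e _ _ N x).mul_left _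
  simp_rw [← tsum_mul_left]
  rw [← Summable.tsum_finsetSum hs]
  refine tsum_congr fun y => ?_
  simp only [noblePiM, Finset.mul_sum, Finset.sum_mul, mul_assoc]
  exact Finset.sum_comm

/-- **Proposition 2.1, second NoBLE relation (2.15) at finite `M ≥ 1`** (= (3.49) with (3.45)–(3.57)): for `d ≥ 2`,
`p < p_c`, every direction `ι`, every `M ≥ 1` (written `M + 1`) and `x ∈ ℤ^d`,
`τ_p(x) = τ^ι(x) + μ_p τ^{-ι}(x - e_ι) + Σ_y Σ_κ Π^{ι,κ}_M(y) τ^κ(x - y + e_κ) + Ξ^ι_M(x) + R^ι_M(x)`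
(`Ξ^ι_M`, `Π^{ι,κ}_M` the alternating partial sums (2.16), `R^ι_M = (-1)^{M+1}(|R^{b_ι}_M|(0,x;{e_ι}) + p𝔼[𝟙|R^{B(0)}_{M-1}|])`
as typed in `nobleRIota`; at `M = 0` the tree's `nobleRIota … 0` omits the correction term, whence `M ≥ 1`, matching
the print's "(3.53)–(3.57) for `N, M ≥ 1`").
[cite: FitznerVanDerHofstad2017, Prop. 2.1 (2.15) (arXiv:1506.07977v2 p. 10 = EJP 22 (2017) no. 43 p. 10); (3.46)–(3.54) (arXiv v2 p. 29), (3.55)–(3.57) (p. 30)] -/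
theorem noble_eq_two_finite (hd : 2 ≤ d) {p : unitInterval} (hp : p < criticalProbI d) (ι : Fin d × Bool) (M : ℕ)
    (x : Site d) :
    tau d p 0 x = tauOff d p (Percolation.stepVec ι) x +
      nobleMu d p * tauOff d p (Percolation.stepVec (srev ι)) (x - Percolation.stepVec ι) +
      (∑' y, ∑ κ : Fin d × Bool, noblePiM d p (Percolation.stepVec ι) (Percolation.stepVec κ) (M + 1) y *
        tauOff d p (Percolation.stepVec κ) (x - y + Percolation.stepVec κ)) +
      nobleXiIotaM d p (Percolation.stepVec ι) (M + 1) x + nobleRIota d p (Percolation.stepVec ι) (M + 1) x := by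
  have hpR := coe_lt_criticalProb_of_lt hp
  have hp1 : (p : ℝ) < 1 := lt_of_lt_of_le (show (p : ℝ) < criticalProbI d from hp) (criticalProbI d).2.2
  have hd1 : 1 ≤ d := by omega
  have he : (zdGraph d).Adj 0 (Percolation.stepVec ι) := (zdGraph_adj_iff_stepVec 0 _).2 ⟨ι, (zero_add _).symm⟩
  have he0 : Percolation.stepVec ι ≠ 0 := he.ne.symm
  have htau : tau d p 0 x = tauOff d p (Percolation.stepVec ι) x +
      (bondPercolation (zdGraph d) p (connThrough {Percolation.stepVec ι} 0 x)).toReal := by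
    have h := congrArg ENNReal.toReal (ofReal_tau_eq_add p he0 x)
    rwa [ENNReal.toReal_add ENNReal.ofReal_ne_top (measure_ne_top _ _), ENNReal.toReal_ofReal (tau_nonneg p 0 x),
      ENNReal.toReal_ofReal (tauOff_nonneg p _ x)] at h
  have h := measure_connThrough_toReal_eq_alternating hd hp he (M + 1) x
  rw [ofReal_mul_measure_stepVec_notMem hd1 p hp1 ι, ← ENNReal.ofReal_mul (nobleMu_nonneg d p),
    ENNReal.toReal_ofReal (mul_nonneg (nobleMu_nonneg d p) (tauOff_nonneg p _ _)),
    show nobleRBT d p {s(0, Percolation.stepVec ι)} ∅ (M + 1) {Percolation.stepVec ι} 0 x +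
        ENNReal.ofReal p * nobleIotaCorr d p (Percolation.stepVec ι) (nobleInnerSeq d p (Percolation.stepVec ι) x (M + 1)) =
      nobleRIotaT d p (Percolation.stepVec ι) (M + 1) x from rfl,
    ← nobleRIota_eq p _ (M + 1) x (nobleRBT_ne_top hd _ _ (M + 1) _ _ _ hp) (fun M' hM' =>
      nobleIotaCorr_ne_top_of_le (nobleLevelBound_ne_top p (M' + 1)) fun C =>
        nobleRBT_le_bound hd le_rfl hpR _ _ M' C (Percolation.stepVec ι) x)] at h
  simp_rw [toReal_iota_level_eq hd hp, mul_add, Finset.sum_add_distrib] at h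
  rw [← nobleXiIotaM, sum_alternating_pi_transfer_eq hd hp] at h
  rw [htau, h, stepVec_srev]
  ring

/-! ### I. The completed equations (1.24)–(1.25): `M → ∞` under `N`-summability -/

section Completion

open Filter _root_.Topology

/-- Tonelli for a non-negative real double series: `Σ_N Σ_x F_N(x) < ∞` (each `F_N` summable) gives
`Σ_N F_N(x) < ∞` for every `x` and `Σ_x Σ_N F_N(x) < ∞`. [folklore] -/
theorem summable_swap_of_nonneg {F : ℕ → Site d → ℝ} (h0 : ∀ N x, 0 ≤ F N x) (h1 : ∀ N, Summable (F N))
    (h2 : Summable fun N => ∑' x, F N x) :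
    (∀ x, Summable fun N => F N x) ∧ Summable fun x => ∑' N, F N x := by
  have hprod : Summable (fun q : ℕ × Site d => F q.1 q.2) :=
    (summable_prod_of_nonneg (fun q => h0 q.1 q.2)).2 ⟨h1, h2⟩
  have hsymm : Summable (fun q : Site d × ℕ => F q.2 q.1) := hprod.prod_symm
  exact (summable_prod_of_nonneg (fun q => h0 q.2 q.1)).1 hsymm

/-- Partial sums of an absolutely convergent alternating series converge. [folklore] -/
theorem tendsto_alternating_partial {f : ℕ → ℝ} (hf : Summable f) (h0 : ∀ N, 0 ≤ f N) (k : ℕ) :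
    Tendsto (fun M => ∑ N ∈ Finset.range (M + k), (-1 : ℝ) ^ N * f N) atTop
      (𝓝 (∑' N, (-1 : ℝ) ^ N * f N)) := by
  have hs : Summable fun N => (-1 : ℝ) ^ N * f N :=
    Summable.of_norm_bounded hf (fun N => le_of_eq (by
      rw [norm_mul, norm_pow, norm_neg, norm_one, one_pow, one_mul, Real.norm_eq_abs, abs_of_nonneg (h0 N)]))
  exact (hs.hasSum.tendsto_sum_nat).comp (tendsto_add_atTop_nat k)

/-- `|Σ_{N<M} (-1)^N f_N| ≤ Σ_N f_N` for non-negative summable `f`. [folklore] -/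
theorem abs_alternating_partial_le {f : ℕ → ℝ} (hf : Summable f) (h0 : ∀ N, 0 ≤ f N) (M : ℕ) :
    |∑ N ∈ Finset.range M, (-1 : ℝ) ^ N * f N| ≤ ∑' N, f N := by
  refine (Finset.abs_sum_le_sum_abs _ _).trans ?_
  simp_rw [abs_mul, abs_pow, abs_neg, abs_one, one_pow, one_mul]
  refine le_trans (Finset.sum_le_sum fun N _ => le_of_eq (abs_of_nonneg (h0 N))) ?_
  exact Summable.sum_le_tsum _ (fun N _ => h0 N) hf

/-- `|Σ_N (-1)^N f_N| ≤ Σ_N f_N` for non-negative summable `f`. [folklore] -/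
theorem abs_alternating_tsum_le {f : ℕ → ℝ} (hf : Summable f) (h0 : ∀ N, 0 ≤ f N) :
    |∑' N, (-1 : ℝ) ^ N * f N| ≤ ∑' N, f N := by
  have h : ∀ N, ‖(-1 : ℝ) ^ N * f N‖ = f N := fun N => by
    rw [norm_mul, norm_pow, norm_neg, norm_one, one_pow, one_mul, Real.norm_eq_abs, abs_of_nonneg (h0 N)]
  rw [← Real.norm_eq_abs]
  refine (norm_tsum_le_tsum_norm (by simpa only [h] using hf)).trans (le_of_eq (tsum_congr h))

variable (hd : 2 ≤ d) {p : unitInterval} (hp : p < criticalProbI d)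
include hd hp

/-- `Ψ^{(N),κ}(x) ≤ (p/μ_p) Ξ^{(N)}(x)` for `p < p_c`. [cite: FitznerVanDerHofstad2017, §3.5 (3.74), first relation ([16, Assumption 4.2] for percolation; arXiv:1506.07977v2 p. 32; EJP §3.5 pp. 29–30)] [cite: FitznerVanDerHofstad2016NoBLE, Assumption 4.2 (4.29) (pp. 1085–1086)] -/
theorem noblePsiN_le_mul_nobleXiN (κ : Fin d × Bool) (N : ℕ) (x : Site d) :
    noblePsiN d p (Percolation.stepVec κ) N x ≤ (p : ℝ) / nobleMu d p * nobleXiN d p N x :=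
  noblePsiN_le p _ N x (div_nonneg p.2.1 (nobleMu_nonneg d p)) (nobleXiT_ne_top hd hp N x)

/-- `Π^{(N),ι,κ}(x) ≤ p Ξ^{(N),ι}(x)` for `p < p_c`. [cite: FitznerVanDerHofstad2017, §3.5 (3.74), second relation (arXiv:1506.07977v2 p. 32; EJP §3.5 pp. 29–30)] [cite: FitznerVanDerHofstad2016NoBLE, Assumption 4.2 (4.29) (pp. 1085–1086)] -/
theorem noblePiN_le_mul_nobleXiIotaN (e e' : Site d) (N : ℕ) (x : Site d) :
    noblePiN d p e e' N x ≤ (p : ℝ) * nobleXiIotaN d p e N x :=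
  noblePiN_le p e e' N x (nobleXiIotaT_ne_top hd hp e N x)

/-- `x ↦ Ψ^{(N),κ}(x)` is summable (`p < p_c`). [cite: FitznerVanDerHofstad2017, (3.34)–(3.35), (3.43) (arXiv:1506.07977v2 pp. 27–28)] -/
theorem summable_noblePsiN (e : Site d) (N : ℕ) : Summable (fun x => noblePsiN d p e N x) :=
  Summable.of_nonneg_of_le (fun x => noblePsiN_nonneg' p e N x)
    (fun x => noblePsiN_le p e N x (div_nonneg p.2.1 (nobleMu_nonneg d p)) (nobleXiT_ne_top hd hp N x))
    ((summable_nobleXiN hd hp N).mul_left _)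

/-- `x ↦ Ξ^{(N),ι}(x)` is summable (`p < p_c`). [cite: FitznerVanDerHofstad2017, (3.34), (3.55) (arXiv:1506.07977v2 pp. 27, 30)] -/
theorem summable_nobleXiIotaN (e : Site d) (N : ℕ) : Summable (fun x => nobleXiIotaN d p e N x) :=
  (summable_weighted_nobleXiIotaN hd hp e N (fun _ => 1) (fun _ => by simp)).congr fun x => one_mul _

/-- `x ↦ Π^{(N),ι,κ}(x)` is summable (`p < p_c`). [cite: FitznerVanDerHofstad2017, (3.35), (3.56) (arXiv:1506.07977v2 pp. 27, 30)] -/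
theorem summable_noblePiN (e e' : Site d) (N : ℕ) : Summable (fun x => noblePiN d p e e' N x) :=
  (summable_weighted_noblePiN hd hp e e' N (fun _ => 1) (fun _ => by simp)).congr fun x => one_mul _

/-- From `Σ_N Σ_x Ξ^{(N)}(x) < ∞`: the `N`-series `Σ_N Ξ^{(N)}(x)`, `Σ_N Ψ^{(N),κ}(x)` converge and
`y ↦ Σ_N Ψ^{(N),κ}(y)` is summable. [cite: FitznerVanDerHofstad2017, after (3.37) (arXiv:1506.07977v2 pp. 27–28: "by showing that the remainder term R^B_N converges to zero"); §3.5 (3.74) (p. 32)] -/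
theorem summable_family_of_summable_nobleXiN (hΞ : Summable fun N => ∑' x, nobleXiN d p N x) :
    (∀ x, Summable fun N => nobleXiN d p N x) ∧ (Summable fun x => ∑' N, nobleXiN d p N x) ∧
      (∀ (κ : Fin d × Bool) x, Summable fun N => noblePsiN d p (Percolation.stepVec κ) N x) ∧
      (∀ κ : Fin d × Bool, Summable fun y => ∑' N, noblePsiN d p (Percolation.stepVec κ) N y) ∧
      Summable fun N => ∑' y, ∑ κ : Fin d × Bool, noblePsiN d p (Percolation.stepVec κ) N y := by
  obtain ⟨hΞN, hΞx⟩ := summable_swap_of_nonneg (fun N x => nobleXiN_nonneg p N x)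
    (fun N => summable_nobleXiN hd hp N) hΞ
  have hc : 0 ≤ (p : ℝ) / nobleMu d p := div_nonneg p.2.1 (nobleMu_nonneg d p)
  have hΨN : ∀ (κ : Fin d × Bool) x, Summable fun N => noblePsiN d p (Percolation.stepVec κ) N x :=
    fun κ x => Summable.of_nonneg_of_le (fun N => noblePsiN_nonneg' p _ N x)
      (fun N => noblePsiN_le_mul_nobleXiN hd hp κ N x) ((hΞN x).mul_left _)
  have hΨle : ∀ (κ : Fin d × Bool) y, ∑' N, noblePsiN d p (Percolation.stepVec κ) N y ≤
      (p : ℝ) / nobleMu d p * ∑' N, nobleXiN d p N y := fun κ y => by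
    rw [← tsum_mul_left]
    exact Summable.tsum_le_tsum (fun N => noblePsiN_le_mul_nobleXiN hd hp κ N y) (hΨN κ y) ((hΞN y).mul_left _)
  refine ⟨hΞN, hΞx, hΨN, fun κ => Summable.of_nonneg_of_le (fun y => tsum_nonneg fun N => noblePsiN_nonneg' p _ N y)
    (hΨle κ) (hΞx.mul_left _), ?_⟩
  refine Summable.of_nonneg_of_le (fun N => tsum_nonneg fun y => Finset.sum_nonneg fun κ _ => noblePsiN_nonneg' p _ N y)
    (fun N => ?_) (hΞ.mul_left ((Fintype.card (Fin d × Bool) : ℝ) * ((p : ℝ) / nobleMu d p)))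
  rw [← tsum_mul_left]
  refine Summable.tsum_le_tsum (fun y => ?_) (summable_sum fun κ _ => summable_noblePsiN hd hp _ N)
    ((summable_nobleXiN hd hp N).mul_left _)
  calc ∑ κ : Fin d × Bool, noblePsiN d p (Percolation.stepVec κ) N y
      ≤ ∑ _κ : Fin d × Bool, (p : ℝ) / nobleMu d p * nobleXiN d p N y :=
        Finset.sum_le_sum fun κ _ => noblePsiN_le_mul_nobleXiN hd hp κ N y
    _ = _ := by rw [Finset.sum_const, Finset.card_univ, nsmul_eq_mul, mul_assoc]

/-- From `Σ_N Σ_x Ξ^{(N),ι}(x) < ∞`: the `N`-series `Σ_N Ξ^{(N),ι}(x)`, `Σ_N Π^{(N),ι,κ}(x)` converge and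
`y ↦ Σ_N Π^{(N),ι,κ}(y)` is summable. [cite: FitznerVanDerHofstad2017, §3.3 (arXiv:1506.07977v2 pp. 29–30); §3.5 (3.74) (p. 32)] -/
theorem summable_family_of_summable_nobleXiIotaN (e : Site d)
    (hΞι : Summable fun N => ∑' x, nobleXiIotaN d p e N x) :
    (∀ x, Summable fun N => nobleXiIotaN d p e N x) ∧ (Summable fun x => ∑' N, nobleXiIotaN d p e N x) ∧
      (∀ (κ : Fin d × Bool) x, Summable fun N => noblePiN d p e (Percolation.stepVec κ) N x) ∧
      (∀ κ : Fin d × Bool, Summable fun y => ∑' N, noblePiN d p e (Percolation.stepVec κ) N y) ∧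
      Summable fun N => ∑' y, ∑ κ : Fin d × Bool, noblePiN d p e (Percolation.stepVec κ) N y := by
  obtain ⟨hΞN, hΞx⟩ := summable_swap_of_nonneg (fun N x => nobleXiIotaN_nonneg p e N x)
    (fun N => summable_nobleXiIotaN hd hp e N) hΞι
  have hPiN : ∀ (κ : Fin d × Bool) x, Summable fun N => noblePiN d p e (Percolation.stepVec κ) N x :=
    fun κ x => Summable.of_nonneg_of_le (fun N => noblePiN_nonneg p _ _ N x)
      (fun N => noblePiN_le_mul_nobleXiIotaN hd hp e _ N x) ((hΞN x).mul_left _)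
  have hPile : ∀ (κ : Fin d × Bool) y, ∑' N, noblePiN d p e (Percolation.stepVec κ) N y ≤
      (p : ℝ) * ∑' N, nobleXiIotaN d p e N y := fun κ y => by
    rw [← tsum_mul_left]
    exact Summable.tsum_le_tsum (fun N => noblePiN_le_mul_nobleXiIotaN hd hp e _ N y) (hPiN κ y) ((hΞN y).mul_left _)
  refine ⟨hΞN, hΞx, hPiN, fun κ => Summable.of_nonneg_of_le (fun y => tsum_nonneg fun N => noblePiN_nonneg p _ _ N y)
    (hPile κ) (hΞx.mul_left _), ?_⟩
  refine Summable.of_nonneg_of_le (fun N => tsum_nonneg fun y => Finset.sum_nonneg fun κ _ => noblePiN_nonneg p _ _ N y)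
    (fun N => ?_) (hΞι.mul_left ((Fintype.card (Fin d × Bool) : ℝ) * (p : ℝ)))
  rw [← tsum_mul_left]
  refine Summable.tsum_le_tsum (fun y => ?_) (summable_sum fun κ _ => summable_noblePiN hd hp e _ N)
    ((summable_nobleXiIotaN hd hp e N).mul_left _)
  calc ∑ κ : Fin d × Bool, noblePiN d p e (Percolation.stepVec κ) N y
      ≤ ∑ _κ : Fin d × Bool, (p : ℝ) * nobleXiIotaN d p e N y :=
        Finset.sum_le_sum fun κ _ => noblePiN_le_mul_nobleXiIotaN hd hp e _ N y
    _ = _ := by rw [Finset.sum_const, Finset.card_univ, nsmul_eq_mul, mul_assoc]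

/-- **(1.24) = (2.14) with `M → ∞`**: if `Σ_N Σ_x Ξ^{(N)}_p(x) < ∞` (and `0 < p < p_c`, `d ≥ 2`), then
`τ(x) = δ_{0,x} + Ξ(x) + μ_p [Σ_ι τ^ι(x+e_ι) + Σ_y Σ_ι Ψ^ι(y) τ^ι(x-y+e_ι)]` — the remainder `R_M(x) → 0` by (2.19)
since `Σ_yΣ_κΨ^{(M),κ}(y)` is the general term of a convergent series, and the `y`-sum passes to the limit by
dominated convergence (Tannery). [cite: FitznerVanDerHofstad2017, Prop. 2.1 (2.14) (arXiv:1506.07977v2 p. 10), (2.19) (p. 11) (EJP 22 (2017) no. 43 p. 10); §3.3 (3.44)–(3.45) (arXiv v2 p. 28); after (3.37), pp. 27–28: "This convergence follows from (3.35) and the bounds on Ψ^{B,(N),κ} that we prove in Section 4, by showing that the remainder term R^B_N converges to zero."] -/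
theorem noble_eq_one_of_summable (hp0 : 0 < (p : ℝ)) (hΞ : Summable fun N => ∑' x, nobleXiN d p N x) (x : Site d) :
    tau d p 0 x = (if x = 0 then 1 else 0) + nobleXi d p x +
      nobleMu d p * (∑ ι : Fin d × Bool, tauOff d p (Percolation.stepVec ι) (x + Percolation.stepVec ι) +
        ∑' y, ∑ ι : Fin d × Bool, noblePsi d p ι y * tauOff d p (Percolation.stepVec ι) (x - y + Percolation.stepVec ι)) := by
  obtain ⟨hΞN, -, hΨN, hgΨ, hpsitot⟩ := summable_family_of_summable_nobleXiN hd hp hΞ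
  have TΞ : Tendsto (fun M => nobleXiM d p M x) atTop (𝓝 (nobleXi d p x)) := by
    unfold nobleXiM nobleXi
    exact tendsto_alternating_partial (hΞN x) (fun N => nobleXiN_nonneg p N x) 1
  have TΨ : ∀ (ι : Fin d × Bool) y, Tendsto (fun M => noblePsiM d p (Percolation.stepVec ι) M y) atTop
      (𝓝 (noblePsi d p ι y)) := fun ι y => by
    unfold noblePsiM noblePsi
    exact tendsto_alternating_partial (hΨN ι y) (fun N => noblePsiN_nonneg' p _ N y) 1
  have TS : Tendsto (fun M => ∑' y, ∑ ι : Fin d × Bool, noblePsiM d p (Percolation.stepVec ι) M y *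
      tauOff d p (Percolation.stepVec ι) (x - y + Percolation.stepVec ι)) atTop
      (𝓝 (∑' y, ∑ ι : Fin d × Bool, noblePsi d p ι y * tauOff d p (Percolation.stepVec ι) (x - y + Percolation.stepVec ι))) := by
    refine tendsto_tsum_of_dominated_convergence
      (bound := fun y => ∑ ι : Fin d × Bool, ∑' N, noblePsiN d p (Percolation.stepVec ι) N y)
      (summable_sum fun ι _ => hgΨ ι) (fun y => tendsto_finsetSum _ fun ι _ => (TΨ ι y).mul_const _)
      (Eventually.of_forall fun M y => ?_)
    rw [Real.norm_eq_abs]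
    refine (Finset.abs_sum_le_sum_abs _ _).trans (Finset.sum_le_sum fun ι _ => ?_)
    rw [abs_mul, abs_of_nonneg (tauOff_nonneg p _ _)]
    refine (mul_le_of_le_one_right (abs_nonneg _) (tauOff_le_one p _ _)).trans ?_
    unfold noblePsiM
    exact abs_alternating_partial_le (hΨN ι y) (fun N => noblePsiN_nonneg' p _ N y) _
  have TR : Tendsto (fun M => nobleR d p M x) atTop (𝓝 0) := by
    refine squeeze_zero_norm' ?_ hpsitot.tendsto_atTop_zero
    refine Filter.eventually_atTop.2 ⟨1, fun M hM => ?_⟩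
    obtain ⟨M', rfl⟩ := Nat.exists_eq_add_of_le' hM
    rw [Real.norm_eq_abs]
    exact abs_nobleR_le_tsum_noblePsiN hd hp0 hp M' x
  have Tall := ((tendsto_const_nhds (x := (if x = 0 then (1 : ℝ) else 0))).add TΞ).add
    (((tendsto_const_nhds (x := ∑ ι : Fin d × Bool, tauOff d p (Percolation.stepVec ι)
      (x + Percolation.stepVec ι))).add TS).const_mul (nobleMu d p)) |>.add TR
  rw [add_zero] at Tall
  have hconst : (fun M => (if x = 0 then (1 : ℝ) else 0) + nobleXiM d p M x +
      nobleMu d p * (∑ ι : Fin d × Bool, tauOff d p (Percolation.stepVec ι) (x + Percolation.stepVec ι) +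
        ∑' y, ∑ ι : Fin d × Bool, noblePsiM d p (Percolation.stepVec ι) M y *
          tauOff d p (Percolation.stepVec ι) (x - y + Percolation.stepVec ι)) + nobleR d p M x) =
      fun _ => tau d p 0 x := funext fun M => (noble_eq_one_finite hd hp M x).symm
  rw [hconst] at Tall
  exact tendsto_nhds_unique tendsto_const_nhds Tall

/-- **(1.25) = (2.15) with `M → ∞`**: if `Σ_N Σ_x Ξ^{(N),ι}_p(x) < ∞` (and `p < p_c`, `d ≥ 2`), then
`τ(x) = τ^ι(x) + μ_p τ^{-ι}(x - e_ι) + Σ_y Σ_κ Π^{ι,κ}(y) τ^κ(x-y+e_κ) + Ξ^ι(x)` — `R^ι_M(x) → 0` by (2.20), the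
`y`-sum by dominated convergence. [cite: FitznerVanDerHofstad2017, Prop. 2.1 (2.15) (arXiv:1506.07977v2 p. 10), (2.20) (p. 11) (EJP 22 (2017) no. 43 p. 10); §3.3 (3.46)–(3.57) (arXiv v2 pp. 29–30); after (3.37) (pp. 27–28)] -/
theorem noble_eq_two_of_summable (ι : Fin d × Bool)
    (hΞι : Summable fun N => ∑' x, nobleXiIotaN d p (Percolation.stepVec ι) N x) (x : Site d) :
    tau d p 0 x = tauOff d p (Percolation.stepVec ι) x +
      nobleMu d p * tauOff d p (Percolation.stepVec (srev ι)) (x - Percolation.stepVec ι) +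
      (∑' y, ∑ κ : Fin d × Bool, noblePi d p ι κ y * tauOff d p (Percolation.stepVec κ) (x - y + Percolation.stepVec κ)) +
      nobleXiIota d p ι x := by
  obtain ⟨hΞN, -, hPiN, hgPi, hpitot⟩ := summable_family_of_summable_nobleXiIotaN hd hp (Percolation.stepVec ι) hΞι
  have TΞ : Tendsto (fun M => nobleXiIotaM d p (Percolation.stepVec ι) (M + 1) x) atTop
      (𝓝 (nobleXiIota d p ι x)) := by
    unfold nobleXiIotaM nobleXiIota
    exact tendsto_alternating_partial (hΞN x) (fun N => nobleXiIotaN_nonneg p _ N x) 2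
  have TPi : ∀ (κ : Fin d × Bool) y, Tendsto (fun M => noblePiM d p (Percolation.stepVec ι) (Percolation.stepVec κ)
      (M + 1) y) atTop (𝓝 (noblePi d p ι κ y)) := fun κ y => by
    unfold noblePiM noblePi
    exact tendsto_alternating_partial (hPiN κ y) (fun N => noblePiN_nonneg p _ _ N y) 2
  have TS : Tendsto (fun M => ∑' y, ∑ κ : Fin d × Bool, noblePiM d p (Percolation.stepVec ι) (Percolation.stepVec κ)
      (M + 1) y * tauOff d p (Percolation.stepVec κ) (x - y + Percolation.stepVec κ)) atTop
      (𝓝 (∑' y, ∑ κ : Fin d × Bool, noblePi d p ι κ y *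
        tauOff d p (Percolation.stepVec κ) (x - y + Percolation.stepVec κ))) := by
    refine tendsto_tsum_of_dominated_convergence
      (bound := fun y => ∑ κ : Fin d × Bool, ∑' N, noblePiN d p (Percolation.stepVec ι) (Percolation.stepVec κ) N y)
      (summable_sum fun κ _ => hgPi κ) (fun y => tendsto_finsetSum _ fun κ _ => (TPi κ y).mul_const _)
      (Eventually.of_forall fun M y => ?_)
    rw [Real.norm_eq_abs]
    refine (Finset.abs_sum_le_sum_abs _ _).trans (Finset.sum_le_sum fun κ _ => ?_)
    rw [abs_mul, abs_of_nonneg (tauOff_nonneg p _ _)]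
    refine (mul_le_of_le_one_right (abs_nonneg _) (tauOff_le_one p _ _)).trans ?_
    unfold noblePiM
    exact abs_alternating_partial_le (hPiN κ y) (fun N => noblePiN_nonneg p _ _ N y) _
  have TR : Tendsto (fun M => nobleRIota d p (Percolation.stepVec ι) (M + 1) x) atTop (𝓝 0) := by
    refine squeeze_zero_norm' (Eventually.of_forall fun M => ?_)
      (hpitot.tendsto_atTop_zero.comp (tendsto_add_atTop_nat 1))
    rw [Real.norm_eq_abs]
    exact abs_nobleRIota_le_tsum_noblePiN hd hp _ M x
  have Tall := (((tendsto_const_nhds (x := tauOff d p (Percolation.stepVec ι) x +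
      nobleMu d p * tauOff d p (Percolation.stepVec (srev ι)) (x - Percolation.stepVec ι))).add TS).add TΞ).add TR
  rw [add_zero] at Tall
  have hconst : (fun M => tauOff d p (Percolation.stepVec ι) x +
      nobleMu d p * tauOff d p (Percolation.stepVec (srev ι)) (x - Percolation.stepVec ι) +
      (∑' y, ∑ κ : Fin d × Bool, noblePiM d p (Percolation.stepVec ι) (Percolation.stepVec κ) (M + 1) y *
        tauOff d p (Percolation.stepVec κ) (x - y + Percolation.stepVec κ)) +
      nobleXiIotaM d p (Percolation.stepVec ι) (M + 1) x + nobleRIota d p (Percolation.stepVec ι) (M + 1) x) =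
      fun _ => tau d p 0 x := funext fun M => (noble_eq_two_finite hd hp ι M x).symm
  rw [hconst] at Tall
  exact tendsto_nhds_unique tendsto_const_nhds Tall

/-- **The `x`-space NoBLE equations (1.24)–(1.25) for percolation** at `0 < p < p_c(d)`, `d ≥ 2`, from the
`N`-summability of the coefficients `Σ_N Σ_x Ξ^{(N)}_p(x) < ∞` and `Σ_N Σ_x Ξ^{(N),ι}_p(x) < ∞` (the only input
that is not a theorem below `p_c`: it is where the bootstrap bounds `Γ₁, Γ₂, Γ₃` of [NoBLE17] enter — e.g. the
`NSumLE` clauses of `NobleAssumption43At`). The remaining convergences (`Ψ ≤ (p/μ_p)Ξ`, `Π ≤ pΞ^ι`, the `y`-sums,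
`R_M, R^ι_M → 0`) are derived. [cite: FitznerVanDerHofstad2017, Prop. 2.1 (arXiv:1506.07977v2 pp. 10–11; EJP 22 (2017) no. 43 p. 10); §3.3 (arXiv v2 pp. 28–30); §3.5 (3.74) (p. 32)] [cite: FitznerVanDerHofstad2016NoBLE, (1.24)–(1.26) (pp. 1048–1049)] -/
theorem percolationNobleEquationAt_of_summable (hp0 : 0 < (p : ℝ)) (hΞ : Summable fun N => ∑' x, nobleXiN d p N x)
    (hΞι : ∀ ι : Fin d × Bool, Summable fun N => ∑' x, nobleXiIotaN d p (Percolation.stepVec ι) N x) :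
    PercolationNobleEquationAt d p := by
  obtain ⟨hΞN, -, hΨN, hgΨ, -⟩ := summable_family_of_summable_nobleXiN hd hp hΞ
  have hι := fun ι => summable_family_of_summable_nobleXiIotaN hd hp (Percolation.stepVec ι) (hΞι ι)
  refine ⟨hΞN, hΨN, fun ι => (hι ι).1, fun ι κ => (hι ι).2.2.1 κ, fun x => ?_, fun ι x => ?_,
    noble_eq_one_of_summable hd hp hp0 hΞ, fun ι => noble_eq_two_of_summable hd hp ι (hΞι ι)⟩
  · refine Summable.of_nonneg_of_le (fun y => Finset.sum_nonneg fun ι _ => mul_nonneg (abs_nonneg _) (tauOff_nonneg p _ _))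
      (fun y => Finset.sum_le_sum fun ι _ => ?_) (summable_sum fun ι _ => hgΨ ι)
    refine (mul_le_of_le_one_right (abs_nonneg _) (tauOff_le_one p _ _)).trans ?_
    unfold noblePsi
    exact abs_alternating_tsum_le (hΨN ι y) (fun N => noblePsiN_nonneg' p _ N y)
  · refine Summable.of_nonneg_of_le (fun y => Finset.sum_nonneg fun κ _ => mul_nonneg (abs_nonneg _) (tauOff_nonneg p _ _))
      (fun y => Finset.sum_le_sum fun κ _ => ?_) (summable_sum fun κ _ => (hι ι).2.2.2.1 κ)
    refine (mul_le_of_le_one_right (abs_nonneg _) (tauOff_le_one p _ _)).trans ?_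
    unfold noblePi
    exact abs_alternating_tsum_le ((hι ι).2.2.1 κ y) (fun N => noblePiN_nonneg p _ _ N y)

end Completion

/-! ### J. The oracle binder without the NoBLE-equation hypothesis -/

/-- **Bookkeeping with the NoBLE-equation hypothesis `hEq` discharged.**  Same as
`nobleImprovementInputsAt_of_prop45ii_summed` (module `NobleRelationSummed`) WITHOUT its binder
`hEq : ∀ p ∈ (p_I, p_c), PercolationNobleEquationAt d p`: on the NoBLE window the `x`-space NoBLE equations
(1.24)–(1.25) are now the THEOREM `percolationNobleEquationAt_of_summable` — the expansion identities
[FvdH17] Prop. 2.1 / Lemma 3.3 are kernel-proved in this module at every finite `M` (`noble_eq_one_finite`,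
`noble_eq_two_finite`), and the `M → ∞` limit uses exactly the `N`-summability clauses `NSumLE` of Assumption 4.3
(`NobleAssumption43At.xiAbs`, `.xiIotaAbs`) that the binder `h43` already supplies under the bootstrap hypothesis.
The binder `hfact` is still the HYBRID `FitznerVanDerHofstad2016NoBLE_prop45ii` (printed Prop. 4.5(ii) + the
notebook wiring of the `β`'s) — NOT a published theorem and not discharged here; no cited fact is introduced by
this module. [cite: FitznerVanDerHofstad2017, Prop. 2.1 (arXiv:1506.07977v2 pp. 10–11; EJP 22 (2017) no. 43 p. 10), Lemma 3.3 (arXiv v2 p. 23), §3.3 (pp. 28–30)] [cite: FitznerVanDerHofstad2016NoBLE, Prop. 4.5(ii) (p. 1088); Assumption 4.3 (4.31), (4.49) (pp. 1086–1088)] -/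
theorem nobleImprovementInputsAt_of_prop45ii_identity (hd : 2 ≤ d)
    (hfact : FitznerVanDerHofstad2016NoBLE_prop45ii d)
    {cμ : ℝ} {c : Fin 6 → ℝ} {Γ : Fin 3 → ℝ} {i : BetaMap.Inputs} {b : Fin 6 → ℝ} (hWF : NobleInputsWF d i)
    (h43 : ∀ p : unitInterval, p ∈ Set.Ioo (nbwThresholdI d) (criticalProbI d) →
      (∀ j, nobleF d cμ c j p ≤ Γ j) →
        ∃ S : NobleSplit d p, NobleAssumption41At d p S ∧ NobleAssumption43At d p S i ∧
          NobleWeightedDiagramBoundAt d p b) :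
    NobleImprovementInputsAt d cμ c Γ (BetaMap.nobleBetaOfInputs d i) b := by
  intro p hp hΓ
  obtain ⟨S, h41, h43p, hW⟩ := h43 p hp hΓ
  have hp0 : 0 < (p : ℝ) :=
    lt_trans (nbwThresholdI_pos (by omega)) (show (nbwThresholdI d : ℝ) < p by exact_mod_cast hp.1)
  have hEq : PercolationNobleEquationAt d p :=
    percolationNobleEquationAt_of_summable hd hp.2 hp0 h43p.xiAbs.2.1 fun ι => (h43p.xiIotaAbs ι).2.1
  exact ⟨hfact hd p i S hp0 hp.2 hWF hEq h41 (nobleAssumption42At_of_lt_criticalProbI hd hp0 hp.2)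
    (nobleRelationSummedAt_of_mem_Ioo hd hp) h43p, hW⟩

/-- The printed-table variant: the same discharge for the CITABLE fact `FitznerVanDerHofstad2016NoBLE_prop45ii_printed`
(App. D as displayed, `BetaMap.nobleBetaOfInputsPrinted`), which has no summed-relation hypothesis.  Pure logic over
the hypothesis `hfact`; no cited fact introduced. [cite: FitznerVanDerHofstad2016NoBLE, Prop. 4.5(ii) (p. 1088); App. D (pp. 1110–1118)] [cite: FitznerVanDerHofstad2017, Prop. 2.1 (arXiv:1506.07977v2 pp. 10–11; EJP 22 (2017) no. 43 p. 10); §3.3 (arXiv v2 pp. 28–30)] -/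
theorem nobleImprovementInputsAt_of_prop45ii_printed_identity (hd : 2 ≤ d)
    (hfact : FitznerVanDerHofstad2016NoBLE_prop45ii_printed d)
    {cμ : ℝ} {c : Fin 6 → ℝ} {Γ : Fin 3 → ℝ} {i : BetaMap.Inputs} {b : Fin 6 → ℝ} (hWF : NobleInputsWF d i)
    (h43 : ∀ p : unitInterval, p ∈ Set.Ioo (nbwThresholdI d) (criticalProbI d) →
      (∀ j, nobleF d cμ c j p ≤ Γ j) →
        ∃ S : NobleSplit d p, NobleAssumption41At d p S ∧ NobleAssumption43At d p S i ∧
          NobleWeightedDiagramBoundAt d p b) :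
    NobleImprovementInputsAt d cμ c Γ (BetaMap.nobleBetaOfInputsPrinted d i) b := by
  intro p hp hΓ
  obtain ⟨S, h41, h43p, hW⟩ := h43 p hp hΓ
  have hp0 : 0 < (p : ℝ) :=
    lt_trans (nbwThresholdI_pos (by omega)) (show (nbwThresholdI d : ℝ) < p by exact_mod_cast hp.1)
  have hEq : PercolationNobleEquationAt d p :=
    percolationNobleEquationAt_of_summable hd hp.2 hp0 h43p.xiAbs.2.1 fun ι => (h43p.xiIotaAbs ι).2.1
  exact ⟨hfact hd p i S hp0 hp.2 hWF hEq h41 (nobleAssumption42At_of_lt_criticalProbI hd hp0 hp.2) h43p, hW⟩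

/-! ### K. The initial-step binder at `p_I = 1/(2d-1)` without the NoBLE-equation hypothesis -/

/-- **The `x`-space NoBLE equations AT the initial point `p_I = 1/(2d-1)`** (`d ≥ 2`) from the `N`-summability of
the coefficients there: `percolationNobleEquationAt_of_summable` applies because `0 < p_I` (`nbwThresholdI_pos`) and
`p_I < p_c` is a THEOREM (`nbwThresholdI_lt_criticalProbI`, module `NobleInitialPoint`: Grimmett (1.13) with
`λ(d) < 2d-1`), as [NoBLE17] Assumption 2.2 requires of `z_I`.
[cite: FitznerVanDerHofstad2017, Prop. 2.1 (arXiv:1506.07977v2 pp. 10–11; EJP 22 (2017) no. 43 p. 10); §2.4 (p_I = 1/(2d−1))]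
[cite: FitznerVanDerHofstad2016NoBLE, Assumption 2.2 (p. 1058: z_I ∈ [0, z_c)); (1.24)–(1.26) (pp. 1048–1049)] -/
theorem percolationNobleEquationAt_nbwThresholdI_of_summable (hd : 2 ≤ d)
    (hΞ : Summable fun N => ∑' x, nobleXiN d (nbwThresholdI d) N x)
    (hΞι : ∀ ι : Fin d × Bool,
      Summable fun N => ∑' x, nobleXiIotaN d (nbwThresholdI d) (Percolation.stepVec ι) N x) :
    PercolationNobleEquationAt d (nbwThresholdI d) :=
  percolationNobleEquationAt_of_summable hd (nbwThresholdI_lt_criticalProbI hd) (nbwThresholdI_pos (by omega)) hΞ hΞι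

/-- **The initial-step oracle binder with the NoBLE-equation hypothesis discharged.**  Same as
`nobleInitialInputsAt_of_prop45ii` (module `NobleInitialPoint`) WITHOUT its binder
`hEq : PercolationNobleEquationAt d p_I`: at `p_I` the NoBLE equations are the theorem
`percolationNobleEquationAt_nbwThresholdI_of_summable`, the `N`-summabilities being read off the `NSumLE` clauses
`NobleAssumption43At.xiAbs`, `.xiIotaAbs` of Assumption 4.3 at `p_I` that the binder `h43` supplies ([NoBLE17]
Assumption 4.3, closing sentence, p. 1088: "If Assumption 2.2 holds, then the bounds stated above also holds for
`z = z_I` with the constants `β_•` only depending on the dimension `d` and the model.").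
The binder `hfact` is the HYBRID `FitznerVanDerHofstad2016NoBLE_prop45ii` (NOT a published theorem, not discharged);
no cited fact is introduced. [cite: FitznerVanDerHofstad2016NoBLE, Prop. 4.5(ii) (p. 1088); Assumption 4.3 (4.31), (4.49) (pp. 1086–1088); Prop. 2.11 (p. 1061: f_i(z_I) ≤ γ_i)]
[cite: FitznerVanDerHofstad2017, Prop. 2.1 (arXiv v2 pp. 10–11; EJP p. 10), Prop. 2.2 (EJP p. 11), §2.4–§2.5] -/
theorem nobleInitialInputsAt_of_prop45ii_identity (hd : 2 ≤ d)
    (hfact : FitznerVanDerHofstad2016NoBLE_prop45ii d)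
    {i : BetaMap.Inputs} {bi : Fin 6 → ℝ} (hWF : NobleInputsWF d i)
    (h43 : ∃ S : NobleSplit d (nbwThresholdI d),
      NobleAssumption41At d (nbwThresholdI d) S ∧ NobleAssumption43At d (nbwThresholdI d) S i)
    (hW : NobleWeightedDiagramBoundAt d (nbwThresholdI d) bi) :
    NobleInitialInputsAt d (BetaMap.nobleBetaOfInputs d i) bi := by
  obtain ⟨S, h41, h43'⟩ := h43
  exact nobleInitialInputsAt_of_prop45ii hd hfact hWF
    (percolationNobleEquationAt_nbwThresholdI_of_summable hd h43'.xiAbs.2.1 fun ι => (h43'.xiIotaAbs ι).2.1)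
    ⟨S, h41, h43'⟩ hW

/-- The printed-table variant for the CITABLE fact `FitznerVanDerHofstad2016NoBLE_prop45ii_printed` (App. D as
displayed, `BetaMap.nobleBetaOfInputsPrinted`).  Pure logic over `hfact`; no cited fact introduced.
[cite: FitznerVanDerHofstad2016NoBLE, Prop. 4.5(ii) (p. 1088); App. D (pp. 1110–1118); Prop. 2.11 (p. 1061)]
[cite: FitznerVanDerHofstad2017, Prop. 2.1 (arXiv v2 pp. 10–11; EJP p. 10), Prop. 2.2 (EJP p. 11)] -/
theorem nobleInitialInputsAt_of_prop45ii_printed_identity (hd : 2 ≤ d)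
    (hfact : FitznerVanDerHofstad2016NoBLE_prop45ii_printed d)
    {i : BetaMap.Inputs} {bi : Fin 6 → ℝ} (hWF : NobleInputsWF d i)
    (h43 : ∃ S : NobleSplit d (nbwThresholdI d),
      NobleAssumption41At d (nbwThresholdI d) S ∧ NobleAssumption43At d (nbwThresholdI d) S i)
    (hW : NobleWeightedDiagramBoundAt d (nbwThresholdI d) bi) :
    NobleInitialInputsAt d (BetaMap.nobleBetaOfInputsPrinted d i) bi := by
  obtain ⟨S, h41, h43'⟩ := h43
  exact nobleInitialInputsAt_of_prop45ii_printed hd hfact hWF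
    (percolationNobleEquationAt_nbwThresholdI_of_summable hd h43'.xiAbs.2.1 fun ι => (h43'.xiIotaAbs ι).2.1)
    ⟨S, h41, h43'⟩ hW

end Literature.Probability.FitznerVanDerHofstad2017

end
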